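import Mathlib.MeasureTheory.Constructions.Pi
import Mathlib.MeasureTheory.Integral.Prod
import Mathlib.MeasureTheory.Integral.Pi
import Mathlib.MeasureTheory.Integral.DominatedConvergence
import Mathlib.MeasureTheory.Constructions.BorelSpace.Metrizable
import Mathlib.MeasureTheory.MeasurableSpace.MeasurablyGenerated
import Mathlib.Algebra.Order.Ring.Pow
import Literature.Analysis.FluidPDE.BoltzmannGradLimit
import Literature.Analysis.FluidPDE.KacChaos
import Literature.Analysis.FluidPDE.HardSphereUniqueness
import HarnessLib

/-!
# Mode A ⇒ mode B for hard spheres: proofs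
(trunk: FluidKinetic / T-KINETIC, item K5; discharge of the named fact
`Kinetic.TendstoMarginals.tendstoEmpirical` of `Literature.Analysis.FluidPDE.BoltzmannGradLimit`)

Main result: `Kinetic.TendstoMarginals.tendstoEmpirical_holds` — convergence of the BBGKY
marginals in the sense of observables (mode A, `Kinetic.TendstoMarginals`; GST 2013 Def. 6.2.1,
Thm 8) to a chaotic limit `f(t)^{⊗s}` with `f(t)` a probability density implies convergence in
probability of the empirical measure (mode B, `Kinetic.TendstoEmpirical`), following
Sznitman 1991 Prop. 2.2 (i)⇒(ii) in the form of Chaintron–Diez 2022 Lemma 3.19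
(`Literature.Analysis.FluidPDE.KacChaos`: it suffices that the one- and two-particle expectations
of `φ`, `φ ⊗ φ` under the (symmetric) time-`t` law converge to `⟨f, φ⟩`, `⟨f, φ⟩²`). The fact is
proved exactly as stated (Hausdorff, locally compact, σ-compact Borel position space `X` with a
Radon `volume` whose points are null; no countability assumption on the topology of `X`).

The passage from mode A (pointwise in the positions, off the diagonal, velocities tested) to the
convergence of `∫ φ^{⊗s} F_k^{(s)}` (`s = 1, 2`) is organised as follows.

* Fubini: `∫ Ψ F = ∫ (I_{Ψ(x_s, ·)} F)(x_s) dx_s` (`integral_mul_eq_integral_velocityAverage`),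
  and `∫ g(z_0, …, z_{s-1}) ρ(z) dz = ∫ g · nthMarginal N s ρ` (`integral_mul_nthMarginal`).
* Mode A gives `I_{Ψ(x_s,·)}(F_k^{(s)})(x_s) → I_{Ψ(x_s,·)}(f^{⊗s})(x_s) = ∏ θ(x_i)` at *every*
  off-diagonal `x_s` (`TendstoMarginals.tendsto_velocityAverage_apply`); at `s = 1` this is
  everywhere, which makes the limit `θ(x) = ∫ ψ(x, v) f(x, v) dv` measurable although `f` need
  not be; at `s = 2` the exceptional set is a *measurable* subset of the position diagonal, hence
  Lebesgue-null as points are (`ae_of_forall_offDiag_two`; no measurability of the diagonal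
  itself, i.e. no countability assumption on `X`, is needed).
* Domination: `|I_{φ^{⊗s}}| ≤ ‖φ‖^s I_{χ_n^{⊗s}}` with velocity cut-offs `χ_n ↑ 1`
  (`exists_cutoff`); the cut-off masses `∫ I_{χ_n^{⊗s}}(F_k^{(s)}) ≤ ∫ F_k → 1` while their limits
  `(∫ θ_n)^s ↑ 1` by the normalisation `∫∫ f = 1` (Fatou), so a Fatou/Pratt argument with a small
  mass defect (`tendsto_integral_of_dominated_defect`) yields `∫ φ^{⊗s} F_k^{(s)} → (∫∫ φ f)^s`
  (`TendstoMarginals.tendsto_integral_tensorPow_mul_nthMarginal`).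
* The law at time `t` has density `1_{good} W ∘ Φ_{-t}` (`map_flow_particleLaw`), whose deficit
  to the raw transported density `W ∘ Φ_{-t}` (whose marginals mode A is about) has mass `→ 0` by
  mode A at `s = 0`; it is symmetric because the flow commutes a.e. with relabelling
  (`HardSphereFlow.flow_comp_perm_ae` of `Literature.Analysis.FluidPDE.HardSphereUniqueness`,
  from uniqueness of trajectories), which reduces all one/two-particle expectations to the first
  two marginals (`integral_comp_perm_map_flow_particleLaw`); `KacChaos` concludes
  (`tendstoEmpirical_of_flow_comp_perm_ae`).

## References

* A.-S. Sznitman, *Topics in propagation of chaos*, LNM 1464 (1991), Prop. 2.2.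
* L.-P. Chaintron, A. Diez, *Propagation of chaos: a review of models, methods and
  applications. I*, Kinet. Relat. Models 15 (2022), Lemma 3.19.
* I. Gallagher, L. Saint-Raymond, B. Texier, *From Newton to Boltzmann: hard spheres and
  short-range potentials*, Zurich Lectures in Advanced Mathematics, EMS (2013), §1.1,
  §4.2, (4.3.2), Def. 6.2.1, Thm 8.
-/

open MeasureTheory Set Filter Topology
open scoped ENNReal

namespace Literature.Analysis.FluidPDE

noncomputable section

section Kinetic

variable {d : Type*} {X : Type*}

/-! ## Reindexing configuration spaces -/

section Reindex

/-- Juxtaposition of configurations as a volume-preserving measurable equivalence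
`(Fin s → F) × (Fin m → F) ≃ᵐ (Fin (s + m) → F)`, `(z_s, z_m) ↦ Fin.append z_s z_m` (Mathlib's
`sumPiEquivProdPi` and `piCongrLeft finSumFinEquiv`). [folklore] -/
theorem exists_appendEquiv (s m : ℕ) (F : Type*) [MeasureSpace F]
    [SigmaFinite (volume : Measure F)] :
    ∃ e : ((Fin s → F) × (Fin m → F)) ≃ᵐ (Fin (s + m) → F),
      (∀ p, e p = Fin.append p.1 p.2) ∧ MeasurePreserving e volume volume := by
  refine ⟨(MeasurableEquiv.sumPiEquivProdPi (fun _ : Fin s ⊕ Fin m => F)).symm.trans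
    (MeasurableEquiv.piCongrLeft (fun _ : Fin (s + m) => F) finSumFinEquiv), fun p => ?_, ?_⟩
  · funext k
    refine Fin.addCases (fun i => ?_) (fun j => ?_) k
    · rw [Fin.append_left, MeasurableEquiv.trans_apply, MeasurableEquiv.coe_piCongrLeft,
        ← finSumFinEquiv_apply_left, Equiv.piCongrLeft_apply_apply]
      rfl
    · rw [Fin.append_right, MeasurableEquiv.trans_apply, MeasurableEquiv.coe_piCongrLeft,
        ← finSumFinEquiv_apply_right, Equiv.piCongrLeft_apply_apply]
      rfl
  · exact (volume_measurePreserving_piCongrLeft (fun _ : Fin (s + m) => F) finSumFinEquiv).comp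
      (volume_measurePreserving_sumPiEquivProdPi_symm (fun _ : Fin s ⊕ Fin m => F))

/-- Reindexing a configuration along an equality `M = N` of particle numbers, as a
volume-preserving measurable equivalence `(Fin M → F) ≃ᵐ (Fin N → F)`, `z ↦ z ∘ Fin.cast _`
(Mathlib's `piCongrLeft (finCongr _)`). [folklore] -/
theorem exists_castEquiv {M N : ℕ} (h : M = N) (F : Type*) [MeasureSpace F]
    [SigmaFinite (volume : Measure F)] :
    ∃ e : (Fin M → F) ≃ᵐ (Fin N → F),
      (∀ z, e z = fun i => z (Fin.cast h.symm i)) ∧ MeasurePreserving e volume volume := by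
  subst h
  refine ⟨MeasurableEquiv.piCongrLeft (fun _ : Fin M => F) (finCongr rfl), fun z => ?_,
    volume_measurePreserving_piCongrLeft (fun _ : Fin M => F) (finCongr rfl)⟩
  funext i
  simp [MeasurableEquiv.coe_piCongrLeft]

end Reindex

/-! ## Marginals as Fubini integrals -/

section MarginalIntegral

variable [Fintype d] [MeasureSpace X] [SigmaFinite (volume : Measure X)]

/-- **Fubini for marginals**: for an integrable `ρ` on `Config (s + m)` and a bounded measurable
`g` on `Config s`, `∫ g(z_s) ρ(z_s, z_m) d(z_s, z_m) = ∫ g(z_s) (marginal s m ρ)(z_s) dz_s`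
(the marginal being that of GST 2013 (4.3.2)). [folklore] -/
theorem integral_mul_marginal (s m : ℕ) {ρ : Config (s + m) d X → ℝ} (hρ : Integrable ρ)
    {g : Config s d X → ℝ} (hg : Measurable g) {C : ℝ} (hC : ∀ zs, |g zs| ≤ C) :
    ∫ z, g (fun i => z (Fin.castAdd m i)) * ρ z = ∫ zs, g zs * marginal s m ρ zs := by
  obtain ⟨e, he, hmp⟩ := exists_appendEquiv s m (X × EuclideanSpace ℝ d)
  rw [← hmp.integral_comp']
  simp only [he, Fin.append_left]
  have h1 : Integrable (fun p : Config s d X × Config m d X => ρ (Fin.append p.1 p.2)) := by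
    have := (hmp.integrable_comp_emb e.measurableEmbedding).2 hρ
    exact this.congr (Eventually.of_forall fun p => by simp [he])
  have hint : Integrable (fun p : Config s d X × Config m d X => g p.1 * ρ (Fin.append p.1 p.2)) :=
    h1.bdd_mul (hg.comp measurable_fst).aestronglyMeasurable
      (Eventually.of_forall fun p => by simpa [Real.norm_eq_abs] using hC p.1)
  change ∫ p : Config s d X × Config m d X, g p.1 * ρ (Fin.append p.1 p.2) = _
  rw [Measure.volume_eq_prod] at hint ⊢
  rw [integral_prod _ hint]
  refine integral_congr_ae (Eventually.of_forall fun zs => ?_)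
  simp only [marginal]
  exact integral_const_mul _ _

/-- Marginals of integrable functions are integrable. [folklore] -/
theorem integrable_marginal (s m : ℕ) {ρ : Config (s + m) d X → ℝ} (hρ : Integrable ρ) :
    Integrable (marginal s m ρ) := by
  obtain ⟨e, he, hmp⟩ := exists_appendEquiv s m (X × EuclideanSpace ℝ d)
  have h1 : Integrable (fun p : Config s d X × Config m d X => ρ (Fin.append p.1 p.2)) := by
    have := (hmp.integrable_comp_emb e.measurableEmbedding).2 hρ
    exact this.congr (Eventually.of_forall fun p => by simp [he])
  rw [Measure.volume_eq_prod] at h1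
  exact h1.integral_prod_left

/-- Marginals of measurable functions are measurable (measurability of parametric Bochner
integrals). [folklore] -/
theorem measurable_marginal (s m : ℕ) {ρ : Config (s + m) d X → ℝ} (hρ : Measurable ρ) :
    Measurable (marginal s m ρ) := by
  have h1 : Measurable fun p : Config s d X × Config m d X => ρ (Fin.append p.1 p.2) := by
    obtain ⟨e, he, -⟩ := exists_appendEquiv s m (X × EuclideanSpace ℝ d)
    have : (fun p : Config s d X × Config m d X => ρ (Fin.append p.1 p.2)) = ρ ∘ e := by
      funext p; simp [he]
    rw [this]
    exact hρ.comp e.measurable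
  have h2 : StronglyMeasurable fun zs : Config s d X =>
      ∫ zm : Config m d X, (fun p : Config s d X × Config m d X => ρ (Fin.append p.1 p.2)) (zs, zm) :=
    h1.stronglyMeasurable.integral_prod_right'
  exact h2.measurable

omit [SigmaFinite (volume : Measure X)] in
/-- Marginals of nonnegative functions are nonnegative. [folklore] -/
theorem marginal_nonneg (s m : ℕ) {ρ : Config (s + m) d X → ℝ} (hρ : 0 ≤ ρ) (zs : Config s d X) :
    0 ≤ marginal s m ρ zs :=
  integral_nonneg fun _ => hρ _

variable {N s : ℕ}

omit [SigmaFinite (volume : Measure X)] in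
/-- The `nthMarginal` along `s ≤ N` is the marginal of the recast function. [folklore] -/
theorem nthMarginal_of_le (h : s ≤ N) (ρ : Config N d X → ℝ) :
    nthMarginal N s ρ = marginal s (N - s)
      (fun z => ρ fun i => z (Fin.cast (Nat.add_sub_of_le h).symm i)) := by
  simp [nthMarginal, h]

/-- The recast of an integrable function along `s + (N - s) = N` is integrable. [folklore] -/
theorem integrable_recast (h : s ≤ N) {ρ : Config N d X → ℝ} (hρ : Integrable ρ) :
    Integrable (fun z : Config (s + (N - s)) d X =>
      ρ fun i => z (Fin.cast (Nat.add_sub_of_le h).symm i)) := by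
  obtain ⟨e, he, hmp⟩ := exists_castEquiv (Nat.add_sub_of_le h) (X × EuclideanSpace ℝ d)
  have := (hmp.integrable_comp_emb e.measurableEmbedding).2 hρ
  refine this.congr (Eventually.of_forall fun z => ?_)
  rw [Function.comp_apply, he]

/-- **Fubini for `nthMarginal`**: for `s ≤ N`, an integrable `ρ` on `Config N` and a bounded
measurable `g` on `Config s`,
`∫ g(z_0, …, z_{s-1}) ρ(z) dz = ∫ g(z_s) (nthMarginal N s ρ)(z_s) dz_s` (the marginal being that
of GST 2013 (4.3.2)). [folklore] -/
theorem integral_mul_nthMarginal (h : s ≤ N) {ρ : Config N d X → ℝ} (hρ : Integrable ρ)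
    {g : Config s d X → ℝ} (hg : Measurable g) {C : ℝ} (hC : ∀ zs, |g zs| ≤ C) :
    ∫ z, g (fun i => z (Fin.castLE h i)) * ρ z = ∫ zs, g zs * nthMarginal N s ρ zs := by
  rw [nthMarginal_of_le h, ← integral_mul_marginal s (N - s) (integrable_recast h hρ) hg hC]
  obtain ⟨e, he, hmp⟩ := exists_castEquiv (Nat.add_sub_of_le h) (X × EuclideanSpace ℝ d)
  rw [← hmp.integral_comp']
  refine integral_congr_ae (Eventually.of_forall fun z => ?_)
  simp only [he]
  rfl

/-- `nthMarginal` of an integrable function is integrable (`s ≤ N`). [folklore] -/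
theorem integrable_nthMarginal (h : s ≤ N) {ρ : Config N d X → ℝ} (hρ : Integrable ρ) :
    Integrable (nthMarginal N s ρ) := by
  rw [nthMarginal_of_le h]
  exact integrable_marginal _ _ (integrable_recast h hρ)

/-- `nthMarginal` of a measurable function is measurable. [folklore] -/
theorem measurable_nthMarginal (N s : ℕ) {ρ : Config N d X → ℝ} (hρ : Measurable ρ) :
    Measurable (nthMarginal N s ρ) := by
  by_cases h : s ≤ N
  · rw [nthMarginal_of_le h]
    refine measurable_marginal _ _ (hρ.comp ?_)
    exact measurable_pi_lambda _ fun i => measurable_pi_apply _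
  · simp only [nthMarginal, h, dif_neg, not_false_eq_true]
    exact measurable_const

omit [SigmaFinite (volume : Measure X)] in
/-- `nthMarginal` of a nonnegative function is nonnegative. [folklore] -/
theorem nthMarginal_nonneg (N s : ℕ) {ρ : Config N d X → ℝ} (hρ : 0 ≤ ρ) (zs : Config s d X) :
    0 ≤ nthMarginal N s ρ zs := by
  by_cases h : s ≤ N
  · rw [nthMarginal_of_le h]
    exact marginal_nonneg _ _ (fun _ => hρ _) zs
  · simp [nthMarginal, h]

/-- The total integral of `nthMarginal N s ρ` is that of `ρ` (`s ≤ N`, `ρ` integrable). [folklore] -/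
theorem integral_nthMarginal (h : s ≤ N) {ρ : Config N d X → ℝ} (hρ : Integrable ρ) :
    ∫ zs, nthMarginal N s ρ zs = ∫ z, ρ z := by
  have := integral_mul_nthMarginal h hρ (g := fun _ => (1 : ℝ)) measurable_const (C := 1)
    (fun _ => by simp)
  simpa using this.symm

/-- The `0`-th marginal is the constant "total integral". [folklore] -/
theorem nthMarginal_zero_apply (ρ : Config N d X → ℝ) (z0 : Config 0 d X) :
    nthMarginal N 0 ρ z0 = ∫ z, ρ z := by
  rw [nthMarginal_of_le (Nat.zero_le N)]
  simp only [marginal]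
  obtain ⟨e, he, hmp⟩ := exists_castEquiv (Nat.sub_zero N) (X × EuclideanSpace ℝ d)
  rw [← hmp.integral_comp']
  refine integral_congr_ae (Eventually.of_forall fun zm => ?_)
  have happ : ∀ j : Fin (0 + (N - 0)), Fin.append z0 zm j = zm (Fin.cast (Nat.zero_add _) j) := by
    intro j
    have hj : j = Fin.natAdd 0 (Fin.cast (Nat.zero_add _) j) := Fin.ext (by simp)
    conv_lhs => rw [hj]
    rw [Fin.append_right]
  simp only [he, happ]
  rfl

end MarginalIntegral

/-! ## The position/velocity split and velocity averages -/

section Split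

variable [Fintype d] [MeasureSpace X]

omit [Fintype d] in
/-- Assembling positions and velocities, `(x_s, v_s) ↦ (i ↦ (x_i, v_i))`, is measurable. [folklore] -/
theorem measurable_zip (s : ℕ) :
    Measurable fun p : (Fin s → X) × (Fin s → EuclideanSpace ℝ d) =>
      (fun i => (p.1 i, p.2 i) : Config s d X) :=
  measurable_pi_lambda _ fun i =>
    ((measurable_pi_apply i).comp measurable_fst).prodMk ((measurable_pi_apply i).comp measurable_snd)

omit [Fintype d] in
/-- A measurable function of configurations, read in split variables, is measurable. [folklore] -/
theorem measurable_comp_zip {s : ℕ} {F : Config s d X → ℝ} (hF : Measurable F) :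
    Measurable fun p : (Fin s → X) × (Fin s → EuclideanSpace ℝ d) => F fun i => (p.1 i, p.2 i) :=
  hF.comp (measurable_zip s)

variable [SigmaFinite (volume : Measure X)]

/-- The position/velocity split as a volume-preserving measurable equivalence
`(Fin s → X) × (Fin s → ℝ^d) ≃ᵐ Config s d X`, `(x_s, v_s) ↦ (i ↦ (x_i, v_i))` (the inverse of
Mathlib's `MeasurableEquiv.arrowProdEquivProdArrow`). [folklore] -/
theorem exists_zipEquiv (s : ℕ) :
    ∃ e : ((Fin s → X) × (Fin s → EuclideanSpace ℝ d)) ≃ᵐ Config s d X,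
      (∀ p, e p = fun i => (p.1 i, p.2 i)) ∧ MeasurePreserving e volume volume :=
  ⟨(MeasurableEquiv.arrowProdEquivProdArrow X (EuclideanSpace ℝ d) (Fin s)).symm, fun _ => rfl,
    (volume_measurePreserving_arrowProdEquivProdArrow X (EuclideanSpace ℝ d) (Fin s)).symm _⟩

/-- An integrable function of configurations, read in split variables, is integrable on
`(Fin s → X) × (Fin s → ℝ^d)`. [folklore] -/
theorem integrable_comp_zip {s : ℕ} {F : Config s d X → ℝ} (hF : Integrable F) :
    Integrable (fun p : (Fin s → X) × (Fin s → EuclideanSpace ℝ d) => F fun i => (p.1 i, p.2 i))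
      ((volume : Measure (Fin s → X)).prod volume) := by
  obtain ⟨e, he, hmp⟩ := exists_zipEquiv (d := d) (X := X) s
  have := (hmp.integrable_comp_emb e.measurableEmbedding).2 hF
  rw [← Measure.volume_eq_prod]
  exact this.congr (Eventually.of_forall fun p => by simp [he])

/-- **Fubini for velocity averages of a general observable**: for an integrable `F` on
`Config s` and a bounded measurable `Ψ` on `Config s`,
`∫ Ψ F dz_s = ∫ (I_{Ψ(x_s, ·)} F)(x_s) dx_s`, where at fixed positions `x_s` the observable
`v_s ↦ Ψ(x_s, v_s)` is fed to `velocityAverage` (the observables of GST 2013 Def. 6.2.1,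
Thm 8). [folklore] -/
theorem integral_mul_eq_integral_velocityAverage {s : ℕ} {F : Config s d X → ℝ}
    (hF : Integrable F) {Ψ : Config s d X → ℝ} (hΨ : Measurable Ψ) {C : ℝ} (hC : ∀ z, |Ψ z| ≤ C) :
    ∫ z, Ψ z * F z = ∫ xs, velocityAverage (fun vs => Ψ fun i => (xs i, vs i)) F xs := by
  obtain ⟨e, he, hmp⟩ := exists_zipEquiv (d := d) (X := X) s
  rw [← hmp.integral_comp']
  simp only [he]
  have h1 := (integrable_comp_zip hF).bdd_mul
    ((measurable_comp_zip hΨ).aestronglyMeasurable)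
    (Eventually.of_forall fun p => by simpa [Real.norm_eq_abs] using hC _)
  change ∫ p : (Fin s → X) × (Fin s → EuclideanSpace ℝ d),
    Ψ (fun i => (p.1 i, p.2 i)) * F (fun i => (p.1 i, p.2 i)) = _
  rw [Measure.volume_eq_prod, integral_prod _ h1]
  rfl

/-- Velocity averages of an integrable function against a bounded measurable (position
dependent) observable are integrable in the positions. [folklore] -/
theorem integrable_velocityAverage' {s : ℕ} {F : Config s d X → ℝ} (hF : Integrable F)
    {Ψ : Config s d X → ℝ} (hΨ : Measurable Ψ) {C : ℝ} (hC : ∀ z, |Ψ z| ≤ C) :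
    Integrable fun xs => velocityAverage (fun vs => Ψ fun i => (xs i, vs i)) F xs := by
  have h1 := (integrable_comp_zip hF).bdd_mul
    ((measurable_comp_zip hΨ).aestronglyMeasurable)
    (Eventually.of_forall fun p => by simpa [Real.norm_eq_abs] using hC _)
  exact h1.integral_prod_left

omit [SigmaFinite (volume : Measure X)] in
/-- Velocity averages of a measurable function against a measurable (position dependent)
observable are measurable in the positions. [folklore] -/
theorem measurable_velocityAverage' {s : ℕ} {F : Config s d X → ℝ} (hF : Measurable F)
    {Ψ : Config s d X → ℝ} (hΨ : Measurable Ψ) :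
    Measurable fun xs => velocityAverage (fun vs => Ψ fun i => (xs i, vs i)) F xs := by
  have h1 : Measurable fun p : (Fin s → X) × (Fin s → EuclideanSpace ℝ d) =>
      Ψ (fun i => (p.1 i, p.2 i)) * F (fun i => (p.1 i, p.2 i)) :=
    (measurable_comp_zip hΨ).mul (measurable_comp_zip hF)
  exact (h1.stronglyMeasurable.integral_prod_right').measurable

omit [MeasureSpace X] [SigmaFinite (volume : Measure X)] in
/-- Velocity averages of a nonnegative function against a nonnegative observable are
nonnegative. [folklore] -/
theorem velocityAverage_nonneg {s : ℕ} {F : Config s d X → ℝ} (hF : 0 ≤ F)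
    {φ : (Fin s → EuclideanSpace ℝ d) → ℝ} (hφ : 0 ≤ φ) (xs : Fin s → X) :
    0 ≤ velocityAverage φ F xs :=
  integral_nonneg fun vs => mul_nonneg (hφ vs) (hF _)

/-- **Domination of velocity averages, almost everywhere in the positions**: if `|Ψ| ≤ C Ψ'`
and `F ≥ 0` is integrable, then `|I_{Ψ(x_s,·)} F (x_s)| ≤ C I_{Ψ'(x_s,·)} F (x_s)` for a.e. `x_s`
(namely wherever the section `v_s ↦ F(x_s, v_s)` is integrable). [folklore] -/
theorem ae_abs_velocityAverage_le {s : ℕ} {F : Config s d X → ℝ} (hF : Integrable F)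
    (hF0 : 0 ≤ F) {Ψ Ψ' : Config s d X → ℝ} (hΨ : Measurable Ψ) (hΨ' : Measurable Ψ')
    {B : ℝ} (hB : ∀ z, |Ψ z| ≤ B) {B' : ℝ} (hB' : ∀ z, |Ψ' z| ≤ B') {C : ℝ}
    (hle : ∀ z, |Ψ z| ≤ C * Ψ' z) :
    ∀ᵐ xs : Fin s → X, |velocityAverage (fun vs => Ψ fun i => (xs i, vs i)) F xs| ≤
      C * velocityAverage (fun vs => Ψ' fun i => (xs i, vs i)) F xs := by
  have hsec := (integrable_comp_zip hF).prod_right_ae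
  filter_upwards [hsec] with xs hxs
  have hmz : Measurable fun vs : Fin s → EuclideanSpace ℝ d => (fun i => (xs i, vs i) : Config s d X) :=
    measurable_pi_lambda _ fun i => measurable_const.prodMk (measurable_pi_apply i)
  have hi1 : Integrable fun vs : Fin s → EuclideanSpace ℝ d =>
      Ψ (fun i => (xs i, vs i)) * F (fun i => (xs i, vs i)) :=
    hxs.bdd_mul (hΨ.comp hmz).aestronglyMeasurable
      (Eventually.of_forall fun vs => by simpa [Real.norm_eq_abs] using hB _)
  have hi2 : Integrable fun vs : Fin s → EuclideanSpace ℝ d =>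
      Ψ' (fun i => (xs i, vs i)) * F (fun i => (xs i, vs i)) :=
    hxs.bdd_mul (hΨ'.comp hmz).aestronglyMeasurable
      (Eventually.of_forall fun vs => by simpa [Real.norm_eq_abs] using hB' _)
  simp only [velocityAverage]
  calc |∫ vs : Fin s → EuclideanSpace ℝ d, Ψ (fun i => (xs i, vs i)) * F (fun i => (xs i, vs i))|
      ≤ ∫ vs : Fin s → EuclideanSpace ℝ d,
          |Ψ (fun i => (xs i, vs i)) * F (fun i => (xs i, vs i))| :=
        abs_integral_le_integral_abs
    _ ≤ ∫ vs : Fin s → EuclideanSpace ℝ d,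
          C * (Ψ' (fun i => (xs i, vs i)) * F (fun i => (xs i, vs i))) := by
        refine integral_mono hi1.abs (hi2.const_mul C) fun vs => ?_
        dsimp
        rw [abs_mul, abs_of_nonneg (hF0 _), ← mul_assoc]
        exact mul_le_mul_of_nonneg_right (hle _) (hF0 _)
    _ = C * ∫ vs : Fin s → EuclideanSpace ℝ d,
          Ψ' (fun i => (xs i, vs i)) * F (fun i => (xs i, vs i)) := integral_const_mul _ _

omit [MeasureSpace X] [SigmaFinite (volume : Measure X)] in
/-- The velocity average of a tensor product against a tensor product factorises:
`I_{ψ^{⊗s}(x_s,·)}(g^{⊗s})(x_s) = ∏_i ∫ ψ(x_i, v) g(x_i, v) dv` (Fubini on `(ℝ^d)^s`; no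
integrability needed). [folklore] -/
theorem velocityAverage_tensorPow_tensorPow [MeasurableSpace X] (s : ℕ)
    (ψ g : X × EuclideanSpace ℝ d → ℝ) (xs : Fin s → X) :
    velocityAverage (fun vs => tensorPow s ψ (fun i => (xs i, vs i))) (tensorPow s g) xs =
      ∏ i, ∫ v, ψ (xs i, v) * g (xs i, v) := by
  simp only [velocityAverage, tensorPow, ← Finset.prod_mul_distrib]
  exact integral_fintype_prod_volume_eq_prod (fun i v => ψ (xs i, v) * g (xs i, v))

end Split

/-! ## Two Fatou lemmas and a dominated convergence theorem with mass defect -/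

section Fatou

variable {α : Type*} [MeasurableSpace α] {μ : Measure α}

/-- **Fatou, integrability form**: an a.e. limit of nonnegative functions whose integrals are
eventually bounded by `C` is integrable with integral at most `C`. [folklore] -/
theorem integrable_of_tendsto_of_integral_le {u : ℕ → α → ℝ} {v : α → ℝ}
    (hum : ∀ k, AEStronglyMeasurable (u k) μ) (hu0 : ∀ k, 0 ≤ᵐ[μ] u k)
    (hlim : ∀ᵐ x ∂μ, Tendsto (fun k => u k x) atTop (𝓝 (v x))) {C : ℝ}
    (hC : ∀ᶠ k in atTop, Integrable (u k) μ ∧ ∫ x, u k x ∂μ ≤ C) :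
    Integrable v μ ∧ ∫ x, v x ∂μ ≤ C := by
  have hvm : AEStronglyMeasurable v μ := aestronglyMeasurable_of_tendsto_ae atTop hum hlim
  have hv0 : 0 ≤ᵐ[μ] v := by
    filter_upwards [hlim, ae_all_iff.2 hu0] with x hx hx0
    exact ge_of_tendsto' hx fun k => hx0 k
  obtain ⟨k₀, hk₀⟩ := hC.exists
  have hC0 : 0 ≤ C := (integral_nonneg_of_ae (hu0 k₀)).trans hk₀.2
  have key : ∫⁻ x, ENNReal.ofReal (v x) ∂μ ≤ ENNReal.ofReal C := by
    have h1 : ∀ᵐ x ∂μ, ENNReal.ofReal (v x) =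
        liminf (fun k => ENNReal.ofReal (u k x)) atTop := by
      filter_upwards [hlim] with x hx
      exact ((ENNReal.continuous_ofReal.tendsto _).comp hx).liminf_eq.symm
    rw [lintegral_congr_ae h1]
    refine (lintegral_liminf_le' fun k => (hum k).aemeasurable.ennreal_ofReal).trans ?_
    refine liminf_le_of_frequently_le' (hC.frequently.mono fun k hk => ?_)
    rw [← ofReal_integral_eq_lintegral_ofReal hk.1 (hu0 k)]
    exact ENNReal.ofReal_le_ofReal hk.2
  have hvi : Integrable v μ :=
    ⟨hvm, (hasFiniteIntegral_iff_ofReal hv0).2 (key.trans_lt ENNReal.ofReal_lt_top)⟩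
  refine ⟨hvi, ?_⟩
  rw [integral_eq_lintegral_of_nonneg_ae hv0 hvm]
  exact ENNReal.toReal_le_of_le_ofReal hC0 key

/-- **Fatou, `ε`-form**: if `u_k ≥ 0` are (eventually) integrable and at a.e. point either
`v = 0` or `u_k → v`, then eventually `∫ v - ε ≤ ∫ u_k`. [folklore] -/
theorem le_integral_add_of_tendsto {u : ℕ → α → ℝ} {v : α → ℝ}
    (hum : ∀ k, AEStronglyMeasurable (u k) μ)
    (hu : ∀ᶠ k in atTop, Integrable (u k) μ ∧ 0 ≤ᵐ[μ] u k)
    (hvi : Integrable v μ) (hv0 : 0 ≤ᵐ[μ] v)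
    (hlim : ∀ᵐ x ∂μ, v x = 0 ∨ Tendsto (fun k => u k x) atTop (𝓝 (v x))) {ε : ℝ} (hε : 0 < ε) :
    ∀ᶠ k in atTop, ∫ x, v x ∂μ - ε ≤ ∫ x, u k x ∂μ := by
  have h1 : ∀ᵐ x ∂μ, ENNReal.ofReal (v x) ≤ liminf (fun k => ENNReal.ofReal (u k x)) atTop := by
    filter_upwards [hlim] with x hx
    rcases hx with hx | hx
    · simp [hx]
    · exact ((ENNReal.continuous_ofReal.tendsto _).comp hx).liminf_eq.symm.le
  have h2 : ENNReal.ofReal (∫ x, v x ∂μ) ≤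
      liminf (fun k => ENNReal.ofReal (∫ x, u k x ∂μ)) atTop := by
    rw [ofReal_integral_eq_lintegral_ofReal hvi hv0]
    calc ∫⁻ x, ENNReal.ofReal (v x) ∂μ
        ≤ ∫⁻ x, liminf (fun k => ENNReal.ofReal (u k x)) atTop ∂μ := lintegral_mono_ae h1
      _ ≤ liminf (fun k => ∫⁻ x, ENNReal.ofReal (u k x) ∂μ) atTop :=
          lintegral_liminf_le' fun k => (hum k).aemeasurable.ennreal_ofReal
      _ = liminf (fun k => ENNReal.ofReal (∫ x, u k x ∂μ)) atTop := by
          refine liminf_congr ?_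
          filter_upwards [hu] with k hk
          exact (ofReal_integral_eq_lintegral_ofReal hk.1 hk.2).symm
  by_cases hI : ∫ x, v x ∂μ ≤ ε
  · filter_upwards [hu] with k hk
    have := integral_nonneg_of_ae hk.2
    linarith
  · push Not at hI
    have hlt : ENNReal.ofReal (∫ x, v x ∂μ - ε) < ENNReal.ofReal (∫ x, v x ∂μ) :=
      (ENNReal.ofReal_lt_ofReal_iff (by linarith)).2 (by linarith)
    have hev := eventually_lt_of_lt_liminf (hlt.trans_le h2)
    filter_upwards [hev] with k hk
    exact ((ENNReal.ofReal_lt_ofReal_iff' ).1 hk).1.le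

/-- **Dominated convergence with a mass defect** (a Pratt-type lemma): let `H_k → H` a.e. and
suppose that for every `η > 0` there are dominating functions `|H_k| ≤ G_k → G` a.e. (from
some `k` on) with `G` integrable and `∫ G_k ≤ ∫ G + η` eventually. Then `∫ H_k → ∫ H`. (Fatou
applied to `G_k ± H_k`.) [folklore] -/
theorem tendsto_integral_of_dominated_defect {H : ℕ → α → ℝ} {Hl : α → ℝ}
    (hHm : ∀ k, AEStronglyMeasurable (H k) μ)
    (hHl : ∀ᵐ x ∂μ, Tendsto (fun k => H k x) atTop (𝓝 (Hl x)))
    (hdom : ∀ η : ℝ, 0 < η → ∃ (G : ℕ → α → ℝ) (Gl : α → ℝ),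
      (∀ k, AEStronglyMeasurable (G k) μ) ∧ Integrable Gl μ ∧
      (∀ᵐ x ∂μ, Tendsto (fun k => G k x) atTop (𝓝 (Gl x))) ∧
      ∀ᶠ k in atTop, Integrable (G k) μ ∧ Integrable (H k) μ ∧ (∀ᵐ x ∂μ, |H k x| ≤ G k x) ∧
        ∫ x, G k x ∂μ ≤ ∫ x, Gl x ∂μ + η) :
    Tendsto (fun k => ∫ x, H k x ∂μ) atTop (𝓝 (∫ x, Hl x ∂μ)) := by
  have hHlm : AEStronglyMeasurable Hl μ := aestronglyMeasurable_of_tendsto_ae atTop hHm hHl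
  -- a.e. domination of the limit
  have hdomlim : ∀ (G : ℕ → α → ℝ) (Gl : α → ℝ),
      (∀ᵐ x ∂μ, Tendsto (fun k => G k x) atTop (𝓝 (Gl x))) →
      (∀ᶠ k in atTop, ∀ᵐ x ∂μ, |H k x| ≤ G k x) → ∀ᵐ x ∂μ, |Hl x| ≤ Gl x := by
    intro G Gl hG hb
    obtain ⟨k₀, hk₀⟩ := eventually_atTop.1 hb
    have hb' : ∀ᵐ x ∂μ, ∀ k, k₀ ≤ k → |H k x| ≤ G k x := by
      rw [ae_all_iff]
      intro k
      by_cases hk : k₀ ≤ k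
      · filter_upwards [hk₀ k hk] with x hx _ using hx
      · exact Eventually.of_forall fun x hk' => absurd hk' hk
    filter_upwards [hHl, hG, hb'] with x hx hGx hbx
    exact le_of_tendsto_of_tendsto ((continuous_abs.tendsto _).comp hx) hGx
      (eventually_atTop.2 ⟨k₀, hbx⟩)
  have hHli : Integrable Hl μ := by
    obtain ⟨G, Gl, -, hGli, hGl, hev⟩ := hdom 1 one_pos
    have hle := hdomlim G Gl hGl (hev.mono fun k hk => hk.2.2.1)
    exact hGli.mono' hHlm (hle.mono fun x hx => by simpa [Real.norm_eq_abs] using hx)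
  rw [Metric.tendsto_atTop]
  intro ε hε
  obtain ⟨G, Gl, hGm, hGli, hGl, hev⟩ := hdom (ε / 4) (by positivity)
  have hle := hdomlim G Gl hGl (hev.mono fun k hk => hk.2.2.1)
  have hplus := le_integral_add_of_tendsto (μ := μ) (u := fun k x => G k x + H k x)
    (v := fun x => Gl x + Hl x) (fun k => (hGm k).add (hHm k))
    (hev.mono fun k hk => ⟨hk.1.add hk.2.1,
      hk.2.2.1.mono fun x hx => by dsimp; linarith [neg_abs_le (H k x)]⟩)
    (hGli.add hHli) (hle.mono fun x hx => by dsimp; linarith [neg_abs_le (Hl x)])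
    (by filter_upwards [hGl, hHl] with x hG hH; exact Or.inr (hG.add hH))
    (ε := ε / 4) (by positivity)
  have hminus := le_integral_add_of_tendsto (μ := μ) (u := fun k x => G k x - H k x)
    (v := fun x => Gl x - Hl x) (fun k => (hGm k).sub (hHm k))
    (hev.mono fun k hk => ⟨hk.1.sub hk.2.1,
      hk.2.2.1.mono fun x hx => by dsimp; linarith [le_abs_self (H k x)]⟩)
    (hGli.sub hHli) (hle.mono fun x hx => by dsimp; linarith [le_abs_self (Hl x)])
    (by filter_upwards [hGl, hHl] with x hG hH; exact Or.inr (hG.sub hH))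
    (ε := ε / 4) (by positivity)
  obtain ⟨k₀, hk₀⟩ := eventually_atTop.1 (hplus.and (hminus.and hev))
  refine ⟨k₀, fun k hk => ?_⟩
  obtain ⟨h1, h2, hGi, hHi, -, hdef⟩ := hk₀ k hk
  have e1 : ∫ x, G k x + H k x ∂μ = (∫ x, G k x ∂μ) + ∫ x, H k x ∂μ := integral_add hGi hHi
  have e2 : ∫ x, Gl x + Hl x ∂μ = (∫ x, Gl x ∂μ) + ∫ x, Hl x ∂μ := integral_add hGli hHli
  have e3 : ∫ x, G k x - H k x ∂μ = (∫ x, G k x ∂μ) - ∫ x, H k x ∂μ := integral_sub hGi hHi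
  have e4 : ∫ x, Gl x - Hl x ∂μ = (∫ x, Gl x ∂μ) - ∫ x, Hl x ∂μ := integral_sub hGli hHli
  rw [e1, e2] at h1
  rw [e3, e4] at h2
  rw [Real.dist_eq, abs_lt]
  constructor <;> linarith

end Fatou

/-! ## Velocity cut-offs -/

section Cutoff

/-- **Velocity cut-offs**: on a normed group there are continuous functions `χ_n : E → [0, 1]`
with `χ_n = 1` on the ball of radius `n`, `χ_n = 0` outside the ball of radius `n + 1` (hence
`χ_n(v) → 1` for every `v`); e.g. `χ_n(v) = min 1 (max 0 (n + 1 - |v|))`. [folklore] -/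
theorem exists_cutoff (E : Type*) [NormedAddCommGroup E] :
    ∃ χ : ℕ → E → ℝ, (∀ n v, 0 ≤ χ n v) ∧ (∀ n v, |χ n v| ≤ 1) ∧ (∀ n, Continuous (χ n)) ∧
      (∀ {n : ℕ} {v : E}, ‖v‖ ≤ n → χ n v = 1) ∧
      (∀ {n : ℕ} {v : E}, (n : ℝ) + 1 ≤ ‖v‖ → χ n v = 0) ∧
      ∀ v, Tendsto (fun n => χ n v) atTop (𝓝 1) := by
  set χ : ℕ → E → ℝ := fun n v => min 1 (max 0 ((n : ℝ) + 1 - ‖v‖)) with hχ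
  have h0 : ∀ n v, 0 ≤ χ n v := fun n v => le_min zero_le_one (le_max_left _ _)
  have h1 : ∀ n v, χ n v ≤ 1 := fun n v => min_le_left _ _
  have hone : ∀ {n : ℕ} {v : E}, ‖v‖ ≤ n → χ n v = 1 := by
    intro n v h
    simp only [hχ]
    rw [min_eq_left]
    exact le_max_of_le_right (by linarith)
  refine ⟨χ, h0, fun n v => ?_, fun n => ?_, hone, fun {n v} h => ?_, fun v => ?_⟩
  · rw [abs_of_nonneg (h0 n v)]
    exact h1 n v
  · simp only [hχ]
    fun_prop
  · simp only [hχ]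
    rw [max_eq_left (by linarith), min_eq_right zero_le_one]
  · refine tendsto_const_nhds.congr' ?_
    filter_upwards [eventually_ge_atTop ⌈‖v‖⌉₊] with n hn
    exact (hone ((Nat.le_ceil _).trans (by exact_mod_cast hn))).symm

end Cutoff

/-! ## Measurable subsets of the position diagonal are null -/

section Diagonal

variable [MeasureSpace X] [MeasurableSingletonClass X] [SigmaFinite (volume : Measure X)]
  [NullSingletonClass (volume : Measure X)]

/-- A *measurable* set of position configurations contained in `{x_i = x_j}` (`i ≠ j`) is
Lebesgue-null, points of `X` being null (Tonelli, integrating `x_i` first). The set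
`{x_i = x_j}` itself need not be measurable for the product σ-algebra (no countability
assumption is made on `X`). [folklore] -/
theorem measure_null_of_subset_setOf_apply_eq {s : ℕ} {i j : Fin s} (hij : i ≠ j)
    {S : Set (Fin s → X)} (hSm : MeasurableSet S) (hS : S ⊆ {xs | xs i = xs j}) :
    volume S = 0 := by
  classical
  rcases isEmpty_or_nonempty (Fin s → X) with hE | ⟨⟨x₀⟩⟩
  · rw [Set.eq_empty_of_isEmpty S, measure_empty]
  rw [← lintegral_indicator_one hSm, volume_pi, lintegral_eq_lmarginal_univ x₀,
    lmarginal_erase' (S.indicator 1) (measurable_one.indicator hSm) (Finset.mem_univ i)]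
  have hinner : (fun x : Fin s → X => ∫⁻ xi, S.indicator 1 (Function.update x i xi)
      ∂(fun _ : Fin s => (volume : Measure X)) i) = 0 := by
    funext x
    rw [Pi.zero_apply, ← nonpos_iff_eq_zero]
    calc ∫⁻ xi, S.indicator 1 (Function.update x i xi) ∂(volume : Measure X)
        ≤ ∫⁻ xi, ({x j} : Set X).indicator 1 xi ∂(volume : Measure X) := by
          refine lintegral_mono fun xi => ?_
          by_cases hxi : Function.update x i xi ∈ S
          · have h1 : xi = x j := by
              have := hS hxi
              simp only [Set.mem_setOf_eq, Function.update_self,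
                Function.update_of_ne hij.symm] at this
              exact this
            rw [Set.indicator_of_mem hxi, h1, Set.indicator_of_mem (Set.mem_singleton (x j))]
            rfl
          · simp [Set.indicator_of_notMem hxi]
      _ = 0 := by
          rw [lintegral_indicator_one (measurableSet_singleton _), measure_singleton]
      _ ≤ 0 := le_rfl
  rw [hinner]
  simp [lmarginal]

/-- Off-diagonal everywhere implies almost everywhere, for measurable properties of pairs of
positions. [folklore] -/
theorem ae_of_forall_offDiag_two {P : (Fin 2 → X) → Prop} (hP : MeasurableSet {xs | P xs})
    (h : ∀ xs ∈ offDiag (X := X) 2, P xs) : ∀ᵐ xs : Fin 2 → X, P xs := by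
  rw [ae_iff]
  refine measure_null_of_subset_setOf_apply_eq (i := 0) (j := 1) (by decide) hP.compl fun xs hxs => ?_
  by_contra hne
  refine hxs (h xs fun i j hij => ?_)
  fin_cases i <;> fin_cases j
  · exact absurd rfl hij
  · exact hne
  · exact fun heq => hne heq.symm
  · exact absurd rfl hij

end Diagonal

/-! ## Pointwise consequences of mode A -/

section ModeA

variable [Fintype d] [TopologicalSpace X]

/-- Pointwise consequence of mode A: for `ε > 0`, eventually the tested marginals are `ε`-close
uniformly on `[0, T] × K`. [folklore] -/
theorem TendstoMarginals.eventually_abs_sub_lt {Fk : ℕ → (s : ℕ) → ℝ → Config s d X → ℝ}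
    {F : (s : ℕ) → ℝ → Config s d X → ℝ} {T : ℝ} (h : TendstoMarginals Fk F T) (s : ℕ)
    {φ : (Fin s → EuclideanSpace ℝ d) → ℝ} (hφc : Continuous φ) (hφs : HasCompactSupport φ)
    {K : Set (Fin s → X)} (hK : K ⊆ offDiag s) (hKc : IsCompact K) {ε : ℝ} (hε : 0 < ε) :
    ∀ᶠ k in atTop, ∀ t ∈ Icc 0 T, ∀ xs ∈ K,
      |velocityAverage φ (Fk k s t) xs - velocityAverage φ (F s t) xs| < ε := by
  have ht := h s φ hφc hφs K hK hKc
  have hev := (tendsto_order.1 ht).2 (ENNReal.ofReal ε) (ENNReal.ofReal_pos.2 hε)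
  filter_upwards [hev] with k hk t htI xs hxs
  have h1 : ENNReal.ofReal |velocityAverage φ (Fk k s t) xs - velocityAverage φ (F s t) xs| ≤
      ⨆ t ∈ Icc 0 T, ⨆ xs ∈ K,
        ENNReal.ofReal |velocityAverage φ (Fk k s t) xs - velocityAverage φ (F s t) xs| :=
    le_trans (le_iSup₂ (f := fun xs (_ : xs ∈ K) =>
      ENNReal.ofReal |velocityAverage φ (Fk k s t) xs - velocityAverage φ (F s t) xs|) xs hxs)
      (le_iSup₂ (f := fun t (_ : t ∈ Icc 0 T) => ⨆ xs ∈ K,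
        ENNReal.ofReal |velocityAverage φ (Fk k s t) xs - velocityAverage φ (F s t) xs|) t htI)
  exact (ENNReal.ofReal_lt_ofReal_iff hε).1 (h1.trans_lt hk)

/-- **Mode A at a point**: at every off-diagonal position configuration `x_s` and every
`t ∈ [0, T]`, `I_φ(F_k^{(s)}(t))(x_s) → I_φ(F^{(s)}(t))(x_s)` (take `K = {x_s}`). [folklore] -/
theorem TendstoMarginals.tendsto_velocityAverage_apply
    {Fk : ℕ → (s : ℕ) → ℝ → Config s d X → ℝ} {F : (s : ℕ) → ℝ → Config s d X → ℝ} {T : ℝ}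
    (h : TendstoMarginals Fk F T) {t : ℝ} (ht : t ∈ Icc 0 T) (s : ℕ)
    {φ : (Fin s → EuclideanSpace ℝ d) → ℝ} (hφc : Continuous φ) (hφs : HasCompactSupport φ)
    {xs : Fin s → X} (hxs : xs ∈ offDiag s) :
    Tendsto (fun k => velocityAverage φ (Fk k s t) xs) atTop
      (𝓝 (velocityAverage φ (F s t) xs)) := by
  rw [Metric.tendsto_atTop]
  intro ε hε
  have hev := h.eventually_abs_sub_lt s hφc hφs (K := {xs}) (by simpa using hxs)
    isCompact_singleton hε
  obtain ⟨k₀, hk₀⟩ := eventually_atTop.1 hev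
  exact ⟨k₀, fun k hk => by rw [Real.dist_eq]; exact hk₀ k hk t ht xs rfl⟩

omit [TopologicalSpace X] in
/-- On `0` particles the velocity average against the observable `1` is evaluation (the velocity
space `Fin 0 → ℝ^d` is a point carrying the Dirac mass). [folklore] -/
theorem velocityAverage_zero_one [MeasureSpace X] (F : Config 0 d X → ℝ) (xs : Fin 0 → X)
    (z0 : Config 0 d X) : velocityAverage (fun _ => (1 : ℝ)) F xs = F z0 := by
  simp only [velocityAverage, one_mul]
  have : ∀ vs : Fin 0 → EuclideanSpace ℝ d, (fun i => (xs i, vs i)) = z0 := fun vs =>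
    Subsingleton.elim _ _
  simp_rw [this]
  rw [integral_const, smul_eq_mul, volume_pi,
    Measure.pi_of_empty (fun _ : Fin 0 => (volume : Measure (EuclideanSpace ℝ d))) isEmptyElim]
  simp

/-- **Mode A at `s = 0`**: the constants `F_k^{(0)}(t)` converge to `F^{(0)}(t)`. [folklore] -/
theorem TendstoMarginals.tendsto_apply_zero [MeasureSpace X]
    {Fk : ℕ → (s : ℕ) → ℝ → Config s d X → ℝ}
    {F : (s : ℕ) → ℝ → Config s d X → ℝ} {T : ℝ} (h : TendstoMarginals Fk F T) {t : ℝ}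
    (ht : t ∈ Icc 0 T) (z0 : Config 0 d X) :
    Tendsto (fun k => Fk k 0 t z0) atTop (𝓝 (F 0 t z0)) := by
  set xs : Fin 0 → X := fun i => (z0 i).1
  have := h.tendsto_velocityAverage_apply ht 0 (φ := fun _ => (1 : ℝ)) continuous_const
    (HasCompactSupport.of_compactSpace _) (xs := xs) (fun i => i.elim0)
  simpa only [velocityAverage_zero_one _ xs z0] using this

end ModeA

/-! ## From mode A to the convergence of `∫ φ^{⊗s} F_k^{(s)}` -/

section Core

variable [Fintype d] [MeasureSpace X] [TopologicalSpace X] [OpensMeasurableSpace X]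
  [SigmaFinite (volume : Measure X)]

omit [Fintype d] [MeasureSpace X] [TopologicalSpace X] [OpensMeasurableSpace X]
  [SigmaFinite (volume : Measure X)] in
/-- Observables of one particle which are continuous in the velocity and vanish for velocities
outside a fixed compact set give, at fixed positions, velocity observables in `C_c((ℝ^d)^s)`
(the tensor power `v_s ↦ ∏ ψ(x_i, v_i)`). [folklore] -/
theorem continuous_hasCompactSupport_tensorPow_zip {ψ : X × EuclideanSpace ℝ d → ℝ}
    (hψc : ∀ x, Continuous fun v => ψ (x, v)) {KV : Set (EuclideanSpace ℝ d)} (hKV : IsCompact KV)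
    (hψ0 : ∀ x, ∀ v ∉ KV, ψ (x, v) = 0) (s : ℕ) (xs : Fin s → X) :
    Continuous (fun vs : Fin s → EuclideanSpace ℝ d => tensorPow s ψ (fun i => (xs i, vs i))) ∧
      HasCompactSupport (fun vs : Fin s → EuclideanSpace ℝ d =>
        tensorPow s ψ (fun i => (xs i, vs i))) := by
  constructor
  · simp only [tensorPow]
    exact continuous_finsetProd _ fun i _ => (hψc (xs i)).comp (continuous_apply i)
  · refine HasCompactSupport.of_support_subset_isCompact (isCompact_univ_pi fun _ : Fin s => hKV)
      fun vs hvs => ?_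
    by_contra hmem
    simp only [Set.mem_univ_pi, not_forall] at hmem
    obtain ⟨i, hi⟩ := hmem
    exact hvs (Finset.prod_eq_zero (Finset.mem_univ i) (hψ0 _ _ hi))

omit [Fintype d] [TopologicalSpace X] [OpensMeasurableSpace X]
  [SigmaFinite (volume : Measure X)] in
/-- Tensor powers of a measurable one-particle function are measurable. [folklore] -/
theorem measurable_tensorPow {ψ : X × EuclideanSpace ℝ d → ℝ} (hψ : Measurable ψ) (s : ℕ) :
    Measurable (tensorPow s ψ : Config s d X → ℝ) := by
  change Measurable fun z : Config s d X => ∏ i, ψ (z i)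
  exact Finset.measurable_prod _ fun i _ => hψ.comp (measurable_pi_apply i)

omit [Fintype d] [MeasureSpace X] [TopologicalSpace X] [OpensMeasurableSpace X]
  [SigmaFinite (volume : Measure X)] in
/-- Tensor powers of a function bounded by `B` are bounded by `B^s`. [folklore] -/
theorem abs_tensorPow_le {ψ : X × EuclideanSpace ℝ d → ℝ} {B : ℝ}
    (hB : ∀ p, |ψ p| ≤ B) (s : ℕ) (z : Config s d X) : |tensorPow s ψ z| ≤ B ^ s := by
  simp only [tensorPow, Finset.abs_prod]
  calc ∏ i, |ψ (z i)| ≤ ∏ _i : Fin s, B :=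
        Finset.prod_le_prod (fun i _ => abs_nonneg _) fun i _ => hB _
    _ = B ^ s := by simp

omit [Fintype d] [MeasureSpace X] [TopologicalSpace X] [OpensMeasurableSpace X]
  [SigmaFinite (volume : Measure X)] in
/-- Domination of tensor powers: `|ψ| ≤ B ψ'` gives `|ψ^{⊗s}| ≤ B^s ψ'^{⊗s}`. [folklore] -/
theorem abs_tensorPow_le_mul_tensorPow {ψ ψ' : X × EuclideanSpace ℝ d → ℝ} {B : ℝ}
    (hle : ∀ p, |ψ p| ≤ B * ψ' p) (s : ℕ) (z : Config s d X) :
    |tensorPow s ψ z| ≤ B ^ s * tensorPow s ψ' z := by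
  simp only [tensorPow, Finset.abs_prod]
  calc ∏ i, |ψ (z i)| ≤ ∏ i, B * ψ' (z i) :=
        Finset.prod_le_prod (fun i _ => abs_nonneg _) fun i _ => hle _
    _ = B ^ s * ∏ i, ψ' (z i) := by
        rw [Finset.prod_mul_distrib]
        simp

/-- **From mode A to the convergence of `∫ φ^{⊗s} F_k^{(s)}`** (the analytic heart of
"mode A ⇒ mode B": it produces hypothesis (i) of Sznitman 1991 Prop. 2.2, tested on `φ^{⊗s}`,
from mode A in the sense of GST 2013 Def. 6.2.1): let `ρ_k(t) ≥ 0` be measurable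
`N_k`-particle functions (`N_k → ∞`) whose marginals `F_k^{(s)}(t) = (ρ_k(t))^{(s)}` converge in
mode A on `[0, T]` to `f(t)^{⊗s}` with `f(t) ≥ 0`, `∫∫ f(t) = 1`. Then for `t ∈ [0, T]`, every
`φ ∈ C_c(X × ℝ^d)` and every `s` for which "off-diagonal everywhere implies almost everywhere"
for measurable properties of position configurations (`hnull`; true for `s ≤ 2` when points are
null, `ae_of_forall_offDiag_two`), `∫ φ^{⊗s} F_k^{(s)}(t) → (∫∫ φ f(t))^s`. See the module
docstring for the proof. [folklore] -/
theorem TendstoMarginals.tendsto_integral_tensorPow_mul_nthMarginal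
    {Nk : ℕ → ℕ} (hN : Tendsto Nk atTop atTop) {ρ : (k : ℕ) → ℝ → Config (Nk k) d X → ℝ}
    (hρm : ∀ k t, Measurable (ρ k t)) (hρ0 : ∀ k t, 0 ≤ ρ k t)
    {f : ℝ → X × EuclideanSpace ℝ d → ℝ} {T : ℝ} (hf0 : ∀ t ∈ Icc 0 T, 0 ≤ f t)
    (hf1 : ∀ t ∈ Icc 0 T, ∫ x : X, ∫ v : EuclideanSpace ℝ d, f t (x, v) = 1)
    (h : TendstoMarginals (fun k s t => nthMarginal (Nk k) s (ρ k t))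
      (fun s t => tensorPow s (f t)) T)
    {t : ℝ} (ht : t ∈ Icc 0 T) {φ : X × EuclideanSpace ℝ d → ℝ} (hφc : Continuous φ)
    (hφs : HasCompactSupport φ) (s : ℕ)
    (hnull : ∀ P : (Fin s → X) → Prop, MeasurableSet {xs | P xs} →
      (∀ xs ∈ offDiag (X := X) s, P xs) → ∀ᵐ xs : Fin s → X, P xs) :
    Tendsto (fun k => ∫ zs, tensorPow s φ zs * nthMarginal (Nk k) s (ρ k t) zs) atTop
      (𝓝 ((∫ x : X, ∫ v : EuclideanSpace ℝ d, φ (x, v) * f t (x, v)) ^ s)) := by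
  classical
  obtain ⟨cutoff, cutoff_nonneg, abs_cutoff_le, continuous_cutoff, cutoff_eq_one, cutoff_eq_zero,
    tendsto_cutoff⟩ := exists_cutoff (EuclideanSpace ℝ d)
  /- Notation. `V = ℝ^d`; `Fs k s' = F_k^{(s')}(t)`; for a one-particle function `ψ`,
  `θ ψ x = ∫ ψ(x, v) f(t, x, v) dv` and `VA s' ψ F x_s = I_{ψ^{⊗s'}(x_s, ·)} F (x_s)`. -/
  set Fs : ℕ → (s' : ℕ) → Config s' d X → ℝ := fun k s' => nthMarginal (Nk k) s' (ρ k t)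
    with hFs
  set θ : (X × EuclideanSpace ℝ d → ℝ) → X → ℝ := fun ψ x => ∫ v, ψ (x, v) * f t (x, v) with hθ
  set VA : (s' : ℕ) → (X × EuclideanSpace ℝ d → ℝ) → (Config s' d X → ℝ) → (Fin s' → X) → ℝ :=
    fun s' ψ F xs => velocityAverage (fun vs => tensorPow s' ψ (fun i => (xs i, vs i))) F xs
    with hVA
  have hft0 : 0 ≤ f t := hf0 t ht
  -- basic properties of the marginals
  have hFsm : ∀ k s', Measurable (Fs k s') := fun k s' => measurable_nthMarginal _ _ (hρm k t)
  have hFs0 : ∀ k s', 0 ≤ Fs k s' := fun k s' zs => nthMarginal_nonneg _ _ (hρ0 k t) zs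
  /- Step 0: total mass `m_k → 1`, eventual integrability of `ρ_k(t)` and of its marginals. -/
  set m : ℕ → ℝ := fun k => ∫ z, ρ k t z with hm
  have hmt : Tendsto m atTop (𝓝 1) := by
    have := h.tendsto_apply_zero ht (fun i => i.elim0)
    simp only [nthMarginal_zero_apply, tensorPow_zero] at this
    exact this
  have hint : ∀ᶠ k in atTop, Integrable (ρ k t) := by
    filter_upwards [(tendsto_order.1 hmt).1 (1 / 2) (by norm_num)] with k hk
    by_contra hnot
    have : m k = 0 := integral_undef hnot
    simp only [this] at hk
    norm_num at hk
  have hFsi : ∀ s', ∀ᶠ k in atTop, s' ≤ Nk k ∧ Integrable (ρ k t) ∧ Integrable (Fs k s') := by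
    intro s'
    filter_upwards [hN.eventually_ge_atTop s', hint] with k hk hi
    exact ⟨hk, hi, integrable_nthMarginal hk hi⟩
  /- General facts about "admissible" one-particle observables `ψ` (measurable, bounded,
  continuous in `v`, vanishing for `v` off a compact set). -/
  -- (A1) mode A at every off-diagonal point, limit computed by Fubini
  have hA1 : ∀ (ψ : X × EuclideanSpace ℝ d → ℝ) (KV : Set (EuclideanSpace ℝ d)), IsCompact KV →
      (∀ x, Continuous fun v => ψ (x, v)) → (∀ x, ∀ v ∉ KV, ψ (x, v) = 0) →
      ∀ (s' : ℕ) (xs : Fin s' → X), xs ∈ offDiag s' →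
        Tendsto (fun k => VA s' ψ (Fs k s') xs) atTop (𝓝 (∏ i, θ ψ (xs i))) := by
    intro ψ KV hKV hψc hψ0 s' xs hxs
    obtain ⟨hc, hs⟩ := continuous_hasCompactSupport_tensorPow_zip hψc hKV hψ0 s' xs
    have := h.tendsto_velocityAverage_apply ht s' hc hs hxs
    rwa [velocityAverage_tensorPow_tensorPow] at this
  -- (A2) measurability of the velocity averages, for every `k`
  have hA2 : ∀ (ψ : X × EuclideanSpace ℝ d → ℝ), Measurable ψ → ∀ s' k,
      Measurable (VA s' ψ (Fs k s')) := fun ψ hψ s' k =>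
    measurable_velocityAverage' (hFsm k s') (measurable_tensorPow hψ s')
  -- (A3) measurability of `θ ψ`: an everywhere limit of measurable functions (`s = 1`)
  have hA3 : ∀ (ψ : X × EuclideanSpace ℝ d → ℝ) (KV : Set (EuclideanSpace ℝ d)), IsCompact KV →
      (∀ x, Continuous fun v => ψ (x, v)) → (∀ x, ∀ v ∉ KV, ψ (x, v) = 0) → Measurable ψ →
      Measurable (θ ψ) := by
    intro ψ KV hKV hψc hψ0 hψm
    have hg : Measurable fun xs : Fin 1 → X => θ ψ (xs 0) := by
      refine measurable_of_tendsto_metrizable (f := fun k => VA 1 ψ (Fs k 1)) (hA2 ψ hψm 1) ?_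
      rw [tendsto_pi_nhds]
      intro xs
      have := hA1 ψ KV hKV hψc hψ0 1 xs (fun i j hij => absurd (Subsingleton.elim i j) hij)
      simpa using this
    exact hg.comp (measurable_pi_lambda _ fun _ => measurable_id)
  -- (Ae) almost everywhere convergence on `Fin s → X` (via `hnull`)
  have hAe : ∀ (ψ : X × EuclideanSpace ℝ d → ℝ) (KV : Set (EuclideanSpace ℝ d)), IsCompact KV →
      (∀ x, Continuous fun v => ψ (x, v)) → (∀ x, ∀ v ∉ KV, ψ (x, v) = 0) → Measurable ψ →
      ∀ᵐ xs : Fin s → X, Tendsto (fun k => VA s ψ (Fs k s) xs) atTop (𝓝 (∏ i, θ ψ (xs i))) := by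
    intro ψ KV hKV hψc hψ0 hψm
    refine hnull _ ?_ fun xs hxs => hA1 ψ KV hKV hψc hψ0 s xs hxs
    have hlm : Measurable fun xs : Fin s → X => ∏ i, θ ψ (xs i) :=
      Finset.measurable_prod _ fun i _ => (hA3 ψ KV hKV hψc hψ0 hψm).comp (measurable_pi_apply i)
    have hset : {xs : Fin s → X | Tendsto (fun k => VA s ψ (Fs k s) xs) atTop (𝓝 (∏ i, θ ψ (xs i)))}
        = {xs | Tendsto (fun k => VA s ψ (Fs k s) xs - ∏ i, θ ψ (xs i)) atTop (𝓝 0)} := by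
      ext xs
      exact tendsto_sub_nhds_zero_iff.symm
    rw [hset]
    exact measurableSet_tendsto (𝓝 (0 : ℝ)) fun k => (hA2 ψ hψm s k).sub hlm
  -- transfer between `X` and `Fin 1 → X`
  set e₁ := MeasurableEquiv.funUnique (Fin 1) X with he₁def
  have he₁ : MeasurePreserving e₁ volume volume := volume_preserving_funUnique (Fin 1) X
  have he₁c : ∀ xs : Fin 1 → X, (fun _ : Fin 1 => e₁ xs) = xs := fun xs => by
    funext i
    rw [Subsingleton.elim i 0]
    rfl
  -- (A4) integrability of `θ ψ` for `ψ ≥ 0` (Fatou at `s = 1`), with `∫ θ ψ ≤ 2 B`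
  have hA4 : ∀ (ψ : X × EuclideanSpace ℝ d → ℝ) (KV : Set (EuclideanSpace ℝ d)), IsCompact KV →
      (∀ x, Continuous fun v => ψ (x, v)) → (∀ x, ∀ v ∉ KV, ψ (x, v) = 0) → Measurable ψ →
      0 ≤ ψ → ∀ B, 0 ≤ B → (∀ p, |ψ p| ≤ B) → Integrable (θ ψ) := by
    intro ψ KV hKV hψc hψ0 hψm hψ0' B hB0 hB
    set u : ℕ → X → ℝ := fun k x => VA 1 ψ (Fs k 1) (fun _ => x) with hu
    have hum : ∀ k, Measurable (u k) := fun k =>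
      (hA2 ψ hψm 1 k).comp (measurable_pi_lambda _ fun _ => measurable_id)
    have hu0 : ∀ k x, 0 ≤ u k x := fun k x =>
      velocityAverage_nonneg (hFs0 k 1) (fun vs => tensorPow_nonneg hψ0' 1 _) _
    have hlim : ∀ x, Tendsto (fun k => u k x) atTop (𝓝 (θ ψ x)) := by
      intro x
      have := hA1 ψ KV hKV hψc hψ0 1 (fun _ => x)
        (fun i j hij => absurd (Subsingleton.elim i j) hij)
      simpa using this
    refine (integrable_of_tendsto_of_integral_le (μ := volume) (fun k => (hum k).aestronglyMeasurable)
      (fun k => Eventually.of_forall (hu0 k)) (Eventually.of_forall hlim) (C := B * 2) ?_).1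
    filter_upwards [hFsi 1, (tendsto_order.1 hmt).2 2 (by norm_num)] with k hk hmk
    obtain ⟨hk1, hρi, hF1i⟩ := hk
    have hΨm : Measurable (tensorPow 1 ψ : Config 1 d X → ℝ) := measurable_tensorPow hψm 1
    have hΨb : ∀ z : Config 1 d X, |tensorPow 1 ψ z| ≤ B ^ 1 := abs_tensorPow_le hB 1
    have hVi : Integrable (VA 1 ψ (Fs k 1)) := integrable_velocityAverage' hF1i hΨm hΨb
    -- `u k ∘ e₁ = VA 1 ψ (Fs k 1)`
    have hue : (u k ∘ e₁) = VA 1 ψ (Fs k 1) := by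
      funext xs
      simp only [Function.comp_apply, hu, he₁c xs]
    have hui : Integrable (u k) := by
      rw [← he₁.integrable_comp_emb e₁.measurableEmbedding, hue]
      exact hVi
    refine ⟨hui, ?_⟩
    calc ∫ x, u k x = ∫ xs, VA 1 ψ (Fs k 1) xs := by
          rw [← he₁.integral_comp']
          exact integral_congr_ae (Eventually.of_forall fun xs => congrFun hue xs)
      _ = ∫ zs, tensorPow 1 ψ zs * Fs k 1 zs :=
          (integral_mul_eq_integral_velocityAverage hF1i hΨm hΨb).symm
      _ = ∫ z, tensorPow 1 ψ (fun i => z (Fin.castLE hk1 i)) * ρ k t z :=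
          (integral_mul_nthMarginal hk1 hρi hΨm hΨb).symm
      _ ≤ ∫ z, B * ρ k t z := by
          refine integral_mono_of_nonneg (Eventually.of_forall fun z =>
            mul_nonneg (tensorPow_nonneg hψ0' 1 _) (hρ0 k t z)) (hρi.const_mul B)
            (Eventually.of_forall fun z => ?_)
          have := hΨb (fun i => z (Fin.castLE hk1 i))
          rw [pow_one] at this
          exact mul_le_mul_of_nonneg_right ((le_abs_self _).trans this) (hρ0 k t z)
      _ = B * m k := integral_const_mul _ _
      _ ≤ B * 2 := mul_le_mul_of_nonneg_left hmk.le hB0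
  /- Properties of `φ` and of the cut-offs `χ_n(x, v) = cutoff n v`. -/
  obtain ⟨M, hM0, hM⟩ : ∃ M, 0 ≤ M ∧ ∀ p, |φ p| ≤ M := by
    obtain ⟨M, hM⟩ := hφs.exists_bound_of_continuous hφc
    exact ⟨max M 0, le_max_right _ _, fun p => (by simpa using hM p : |φ p| ≤ M).trans (le_max_left _ _)⟩
  have hφm : Measurable φ := hφc.measurable
  set KV : Set (EuclideanSpace ℝ d) := Prod.snd '' tsupport φ with hKVdef
  have hKV : IsCompact KV := hφs.image continuous_snd
  have hφcv : ∀ x, Continuous fun v : EuclideanSpace ℝ d => φ (x, v) := fun x => by fun_prop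
  have hφ0 : ∀ x, ∀ v ∉ KV, φ (x, v) = 0 := fun x v hv => by
    by_contra hne
    exact hv ⟨(x, v), subset_tsupport _ hne, rfl⟩
  obtain ⟨R₀, hR₀⟩ : ∃ R₀ : ℕ, KV ⊆ Metric.closedBall (0 : EuclideanSpace ℝ d) R₀ := by
    obtain ⟨r, hr⟩ := hKV.isBounded.subset_closedBall (0 : EuclideanSpace ℝ d)
    exact ⟨⌈r⌉₊, hr.trans (Metric.closedBall_subset_closedBall (Nat.le_ceil r))⟩
  set χ : ℕ → X × EuclideanSpace ℝ d → ℝ := fun n p => cutoff n p.2 with hχ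
  have hχm : ∀ n, Measurable (χ n) := fun n =>
    (continuous_cutoff n).measurable.comp measurable_snd
  have hχ0 : ∀ n, 0 ≤ χ n := fun n p => cutoff_nonneg n p.2
  have hχ1 : ∀ n p, |χ n p| ≤ 1 := fun n p => abs_cutoff_le n p.2
  have hχc : ∀ n x, Continuous fun v : EuclideanSpace ℝ d => χ n (x, v) := fun n x =>
    continuous_cutoff n
  have hχK : ∀ n : ℕ, IsCompact (Metric.closedBall (0 : EuclideanSpace ℝ d) ((n : ℝ) + 1)) :=
    fun n => isCompact_closedBall _ _
  have hχ0' : ∀ (n : ℕ) x, ∀ v ∉ Metric.closedBall (0 : EuclideanSpace ℝ d) ((n : ℝ) + 1),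
      χ n (x, v) = 0 := by
    intro n x v hv
    rw [Metric.mem_closedBall, dist_zero_right, not_le] at hv
    exact cutoff_eq_zero hv.le
  have hφχ : ∀ n : ℕ, R₀ ≤ n → ∀ p, |φ p| ≤ M * χ n p := by
    intro n hn p
    by_cases hp : p.2 ∈ KV
    · have h1 : χ n p = 1 := by
        refine cutoff_eq_one ?_
        have := hR₀ hp
        rw [Metric.mem_closedBall, dist_zero_right] at this
        exact this.trans (by exact_mod_cast hn)
      rw [h1, mul_one]
      exact hM p
    · have : φ p = 0 := hφ0 p.1 p.2 hp
      rw [this, abs_zero]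
      exact mul_nonneg hM0 (hχ0 n p)
  /- Tightness: `∫ θ (χ n) → 1⁻` as `n → ∞`, from `∫∫ f(t) = 1` (Fatou in `n`). -/
  set n₀ : X → ℝ := fun x => ∫ v, f t (x, v) with hn₀
  have hn₀1 : ∫ x, n₀ x = 1 := hf1 t ht
  have hn₀i : Integrable n₀ := by
    by_contra hnot
    rw [integral_undef hnot] at hn₀1
    exact zero_ne_one hn₀1
  have hn₀0 : 0 ≤ n₀ := fun x => integral_nonneg fun v => hft0 _
  have hθχi : ∀ n, Integrable (θ (χ n)) := fun n =>
    hA4 (χ n) _ (hχK n) (hχc n) (hχ0' n) (hχm n) (hχ0 n) 1 zero_le_one (hχ1 n)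
  have hθχ0 : ∀ n, 0 ≤ θ (χ n) := fun n x =>
    integral_nonneg fun v => mul_nonneg (hχ0 n _) (hft0 _)
  have hθχlim : ∀ x, n₀ x = 0 ∨ Tendsto (fun n => θ (χ n) x) atTop (𝓝 (n₀ x)) := by
    intro x
    by_cases hx : Integrable (fun v => f t (x, v))
    · right
      have := tendsto_integral_of_dominated_convergence (fun v => f t (x, v))
        (F := fun n v => χ n (x, v) * f t (x, v)) (f := fun v => f t (x, v))
        (fun n => ((continuous_cutoff n).aestronglyMeasurable.mul hx.aestronglyMeasurable))
        hx (fun n => Eventually.of_forall fun v => by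
          rw [Real.norm_eq_abs, abs_mul, abs_of_nonneg (hft0 _)]
          exact mul_le_of_le_one_left (hft0 _) (hχ1 n _))
        (Eventually.of_forall fun v => by
          simpa using (tendsto_cutoff v).mul_const (f t (x, v)))
      simpa using this
    · left
      exact integral_undef hx
  have htight : ∀ ε : ℝ, 0 < ε → ∀ᶠ n in atTop, 1 - ε ≤ ∫ x, θ (χ n) x := by
    intro ε hε
    have := le_integral_add_of_tendsto (μ := volume) (u := fun n => θ (χ n)) (v := n₀)
      (fun n => (hθχi n).aestronglyMeasurable)
      (Eventually.of_forall fun n => ⟨hθχi n, Eventually.of_forall (hθχ0 n)⟩)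
      hn₀i (Eventually.of_forall hn₀0) (Eventually.of_forall hθχlim) hε
    simpa only [hn₀1] using this
  /- Main step: dominated convergence with mass defect on `Fin s → X`. -/
  have hmain : Tendsto (fun k => ∫ xs, VA s φ (Fs k s) xs) atTop
      (𝓝 (∫ xs : Fin s → X, ∏ i, θ φ (xs i))) := by
    refine tendsto_integral_of_dominated_defect (μ := volume)
      (fun k => (hA2 φ hφm s k).aestronglyMeasurable) (hAe φ KV hKV hφcv hφ0 hφm) ?_
    intro η hη
    -- choice of `ε` and of the cut-off `n`
    set A : ℝ := M ^ s * (s + 1) with hA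
    have hA0 : 0 ≤ A := by positivity
    set ε : ℝ := min 1 (η / (A + 1)) with hεdef
    have hε0 : 0 < ε := lt_min one_pos (div_pos hη (by linarith))
    have hε1 : ε ≤ 1 := min_le_left _ _
    have hεA : A * ε ≤ η := by
      calc A * ε ≤ A * (η / (A + 1)) := mul_le_mul_of_nonneg_left (min_le_right _ _) hA0
        _ = η * (A / (A + 1)) := by ring
        _ ≤ η * 1 := by
            refine mul_le_mul_of_nonneg_left ?_ hη.le
            rw [div_le_one (by linarith)]
            linarith
        _ = η := mul_one η
    obtain ⟨n, hnR, hn⟩ := ((eventually_ge_atTop R₀).and (htight ε hε0)).exists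
    -- the dominating family
    set I : ℝ := ∫ x, θ (χ n) x with hI
    have hI1 : 1 - ε ≤ I := hn
    have hθm : Measurable (θ (χ n)) := hA3 (χ n) _ (hχK n) (hχc n) (hχ0' n) (hχm n)
    have hGli0 : Integrable (fun xs : Fin s → X => ∏ i, θ (χ n) (xs i)) := by
      have := Integrable.fintype_prod (ι := Fin s) (f := fun _ => θ (χ n)) (μ := fun _ => volume)
        (fun _ => hθχi n)
      rw [← volume_pi] at this
      exact this
    refine ⟨fun k xs => M ^ s * VA s (χ n) (Fs k s) xs, fun xs => M ^ s * ∏ i, θ (χ n) (xs i),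
      fun k => ((hA2 (χ n) (hχm n) s k).const_mul _).aestronglyMeasurable, hGli0.const_mul _,
      (hAe (χ n) _ (hχK n) (hχc n) (hχ0' n) (hχm n)).mono fun xs hxs => hxs.const_mul _, ?_⟩
    filter_upwards [hFsi s, (tendsto_order.1 hmt).2 (1 + ε) (by linarith)] with k hk hmk
    obtain ⟨hks, hρi, hFki⟩ := hk
    have hΦm : Measurable (tensorPow s φ : Config s d X → ℝ) := measurable_tensorPow hφm s
    have hΦb : ∀ z : Config s d X, |tensorPow s φ z| ≤ M ^ s := abs_tensorPow_le hM s
    have hXm : Measurable (tensorPow s (χ n) : Config s d X → ℝ) := measurable_tensorPow (hχm n) s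
    have hXb : ∀ z : Config s d X, |tensorPow s (χ n) z| ≤ 1 ^ s :=
      abs_tensorPow_le (hχ1 n) s
    have hHi : Integrable (VA s φ (Fs k s)) := integrable_velocityAverage' hFki hΦm hΦb
    have hGi : Integrable (VA s (χ n) (Fs k s)) := integrable_velocityAverage' hFki hXm hXb
    refine ⟨hGi.const_mul _, hHi, ?_, ?_⟩
    · exact ae_abs_velocityAverage_le hFki (hFs0 k s) hΦm hXm hΦb hXb
        (abs_tensorPow_le_mul_tensorPow (hφχ n hnR) s)
    · -- the mass defect
      have hmass : ∫ xs, VA s (χ n) (Fs k s) xs ≤ m k := by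
        calc ∫ xs, VA s (χ n) (Fs k s) xs = ∫ zs, tensorPow s (χ n) zs * Fs k s zs :=
              (integral_mul_eq_integral_velocityAverage hFki hXm hXb).symm
          _ = ∫ z, tensorPow s (χ n) (fun i => z (Fin.castLE hks i)) * ρ k t z :=
              (integral_mul_nthMarginal hks hρi hXm hXb).symm
          _ ≤ ∫ z, ρ k t z := by
              refine integral_mono_of_nonneg (Eventually.of_forall fun z =>
                mul_nonneg (tensorPow_nonneg (hχ0 n) s _) (hρ0 k t z)) hρi
                (Eventually.of_forall fun z => ?_)
              have := hXb (fun i => z (Fin.castLE hks i))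
              rw [one_pow] at this
              simpa using mul_le_mul_of_nonneg_right ((le_abs_self _).trans this) (hρ0 k t z)
      have hlim : ∫ xs : Fin s → X, M ^ s * ∏ i, θ (χ n) (xs i) = M ^ s * I ^ s := by
        rw [integral_const_mul, integral_fintype_prod_volume_eq_prod (fun _ : Fin s => θ (χ n)),
          Finset.prod_const, Finset.card_univ, Fintype.card_fin]
      rw [integral_const_mul, hlim]
      -- `M^s m_k ≤ M^s (1 + ε) ≤ M^s (1 - ε)^s + A ε ≤ M^s I^s + η`
      have hbern : 1 - (s : ℝ) * ε ≤ (1 - ε) ^ s := by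
        have := one_add_mul_le_pow (a := -ε) (by linarith) s
        linarith [this, show (1 + -ε) ^ s = (1 - ε) ^ s by ring]
      have hIs : (1 - ε) ^ s ≤ I ^ s := pow_le_pow_left₀ (by linarith) hI1 s
      have hMs : 0 ≤ M ^ s := pow_nonneg hM0 s
      calc M ^ s * ∫ xs, VA s (χ n) (Fs k s) xs ≤ M ^ s * (1 + ε) :=
            mul_le_mul_of_nonneg_left (hmass.trans hmk.le) hMs
        _ = M ^ s * (1 - s * ε) + A * ε := by simp only [hA]; ring
        _ ≤ M ^ s * I ^ s + η := add_le_add (mul_le_mul_of_nonneg_left (hbern.trans hIs) hMs) hεA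
  /- Identification of both sides. -/
  have hlimit : ∫ xs : Fin s → X, ∏ i, θ φ (xs i) =
      (∫ x : X, ∫ v : EuclideanSpace ℝ d, φ (x, v) * f t (x, v)) ^ s := by
    rw [integral_fintype_prod_volume_eq_prod (fun _ : Fin s => θ φ), Finset.prod_const,
      Finset.card_univ, Fintype.card_fin]
  rw [← hlimit]
  refine hmain.congr' ?_
  filter_upwards [hFsi s] with k hk
  obtain ⟨-, -, hFki⟩ := hk
  exact (integral_mul_eq_integral_velocityAverage hFki (measurable_tensorPow hφm s)
    (abs_tensorPow_le hM s)).symm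

end Core

/-! ## The law of the hard-sphere system at time `t` -/

section Laws

variable {α : Type*} {mα : MeasurableSpace α}

/-- **Integrals against two ordered densities**: if `0 ≤ ρ ≤ ρ'` are integrable and `|g| ≤ C`,
then `|∫ g ρ' - ∫ g ρ| ≤ C (∫ ρ' - ∫ ρ)`. [folklore] -/
theorem abs_integral_mul_sub_le {μ : Measure α} {ρ ρ' g : α → ℝ} (hρ : Integrable ρ μ)
    (hρ' : Integrable ρ' μ) (hle : ∀ z, 0 ≤ ρ z ∧ ρ z ≤ ρ' z) (hg : AEStronglyMeasurable g μ)
    {C : ℝ} (hC : ∀ z, |g z| ≤ C) :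
    |(∫ z, g z * ρ' z ∂μ) - ∫ z, g z * ρ z ∂μ| ≤ C * ((∫ z, ρ' z ∂μ) - ∫ z, ρ z ∂μ) := by
  have hb : ∀ᵐ z ∂μ, ‖g z‖ ≤ C :=
    Eventually.of_forall fun z => by rw [Real.norm_eq_abs]; exact hC z
  have h1 : Integrable (fun z => g z * ρ' z) μ := hρ'.bdd_mul hg hb
  have h2 : Integrable (fun z => g z * ρ z) μ := hρ.bdd_mul hg hb
  rw [← integral_sub h1 h2, ← integral_sub hρ' hρ, ← integral_const_mul]
  refine abs_integral_le_integral_abs.trans (integral_mono_of_nonneg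
    (Eventually.of_forall fun z => abs_nonneg _) ((hρ'.sub hρ).const_mul C)
    (Eventually.of_forall fun z => ?_))
  have hz : 0 ≤ ρ' z - ρ z := sub_nonneg.2 (hle z).2
  dsimp only
  rw [← mul_sub, abs_mul, abs_of_nonneg hz]
  exact mul_le_mul_of_nonneg_right (hC z) hz

variable [Fintype d] [MeasureSpace X] [TopologicalSpace X] {G : Geometry d X} {ε : ℝ} {N : ℕ}

/-- The initial law with a density `W` vanishing off the hard-sphere domain is `W dZ_N` on the
whole phase space (the restriction to `D_ε^N` in `particleLaw` is then invisible; neither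
measurability of `W` nor of `D_ε^N` is needed). [folklore] -/
theorem particleLaw_eq_withDensity (Φ : HardSphereFlow G ε N) {W : Config N d X → ℝ}
    (hWD : ∀ z ∉ hardSphereDomain G N ε, W z = 0) :
    particleLaw Φ W = volume.withDensity fun z => ENNReal.ofReal (W z) := by
  ext A hA
  have hsupp : Function.support (fun z => ENNReal.ofReal (W z)) ⊆ hardSphereDomain G N ε := by
    intro z hz
    by_contra hzD
    exact hz (by simp [hWD z hzD])
  rw [particleLaw, withDensity_apply _ hA, withDensity_apply _ hA, liouville_eq,
    Measure.restrict_restrict hA, Set.inter_comm, ← Measure.restrict_restrict' hA]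
  exact setLIntegral_eq_of_support_subset hsupp

/-- A nonnegative density `W` vanishing off `D_ε^N` with `∫ W = 1` defines a probability law.
[folklore] -/
theorem isProbabilityMeasure_particleLaw (Φ : HardSphereFlow G ε N) {W : Config N d X → ℝ}
    (hW0 : 0 ≤ W) (hWD : ∀ z ∉ hardSphereDomain G N ε, W z = 0)
    (hW1 : ∫ z, W z = 1) : IsProbabilityMeasure (particleLaw Φ W) := by
  have hWi : Integrable W := by
    by_contra h
    rw [integral_undef h] at hW1
    exact zero_ne_one hW1
  refine ⟨?_⟩
  rw [particleLaw_eq_withDensity Φ hWD, withDensity_apply _ MeasurableSet.univ,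
    Measure.restrict_univ, ← ofReal_integral_eq_lintegral_ofReal hWi (Eventually.of_forall hW0),
    hW1, ENNReal.ofReal_one]

/-- **The law at time `t`** (mild Liouville equation, GST 2013 §4.2): the push-forward under
`Φ_t` of the initial law `W 1_{D_ε^N} dZ_N` (measurable `W`) has density `1_{good} · W ∘ Φ_{-t}`
with respect to Lebesgue measure on the whole phase space. Uses only that `Φ_t` preserves the
Liouville measure, maps the good set (`⊆ D_ε^N`, conull) to itself and is inverted by `Φ_{-t}`
there. [cite: GST2013, §4.2] -/
theorem map_flow_particleLaw (Φ : HardSphereFlow G ε N) {W : Config N d X → ℝ}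
    (hWm : Measurable W) (t : ℝ) :
    (particleLaw Φ W).map (Φ.flow t) = volume.withDensity fun z =>
      ENNReal.ofReal (Φ.good.indicator (hsTransport Φ t W) z) := by
  ext A hA
  rw [Measure.map_apply (Φ.measurable_flow t) hA, particleLaw, withDensity_apply _
    (Φ.measurable_flow t hA), withDensity_apply _ hA]
  -- the integrand on the left, as a function of `Φ_t z` (valid on the good set)
  set H : Config N d X → ℝ≥0∞ := fun w =>
    A.indicator (fun w => ENNReal.ofReal (Φ.good.indicator (hsTransport Φ t W) w)) w with hH
  have hHm : Measurable H := by
    refine Measurable.indicator ?_ hA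
    exact ENNReal.measurable_ofReal.comp
      ((hWm.comp (Φ.measurable_flow (-t))).indicator Φ.measurableSet_good)
  have hae : (fun z => (Φ.flow t ⁻¹' A).indicator (fun z => ENNReal.ofReal (W z)) z)
      =ᵐ[liouville G N ε] fun z => H (Φ.flow t z) := by
    filter_upwards [Φ.ae_mem_good] with z hz
    have hgt : Φ.flow t z ∈ Φ.good := Φ.mapsTo_good t hz
    by_cases hzA : Φ.flow t z ∈ A
    · have hzA' : z ∈ Φ.flow t ⁻¹' A := hzA
      simp [hH, Set.indicator_of_mem hzA', Set.indicator_of_mem hzA, Set.indicator_of_mem hgt,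
        hsTransport_apply, Φ.flow_neg_flow t hz]
    · have hzA' : z ∉ Φ.flow t ⁻¹' A := hzA
      simp [hH, Set.indicator_of_notMem hzA', Set.indicator_of_notMem hzA]
  rw [← lintegral_indicator (Φ.measurable_flow t hA), lintegral_congr_ae hae,
    (Φ.measurePreserving t).lintegral_comp hHm]
  -- back on the right: `H` vanishes off `good ⊆ D`, so Liouville = Lebesgue for it
  have hsupp : Function.support H ⊆ hardSphereDomain G N ε := by
    intro w hw
    by_contra hwD
    have hwg : w ∉ Φ.good := fun h => hwD (Φ.good_subset h)
    exact hw (by simp [hH, Set.indicator, hwg])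
  rw [liouville_eq, setLIntegral_eq_of_support_subset hsupp, hH, lintegral_indicator hA]

/-- The law at time `t` is a probability law. [folklore] -/
theorem isProbabilityMeasure_map_flow_particleLaw (Φ : HardSphereFlow G ε N)
    {W : Config N d X → ℝ} (hW0 : 0 ≤ W)
    (hWD : ∀ z ∉ hardSphereDomain G N ε, W z = 0) (hW1 : ∫ z, W z = 1) (t : ℝ) :
    IsProbabilityMeasure ((particleLaw Φ W).map (Φ.flow t)) :=
  haveI := isProbabilityMeasure_particleLaw Φ hW0 hWD hW1
  Measure.isProbabilityMeasure_map (Φ.measurable_flow t).aemeasurable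

omit [TopologicalSpace X] in
/-- The time-`t` density `1_{good} · W ∘ Φ_{-t}` is nonnegative and dominated by the raw
transported density `W ∘ Φ_{-t}` (`W ≥ 0`). [folklore] -/
theorem indicator_hsTransport_le [TopologicalSpace X] (Φ : HardSphereFlow G ε N)
    {W : Config N d X → ℝ} (hW0 : 0 ≤ W) (t : ℝ) (z : Config N d X) :
    0 ≤ Φ.good.indicator (hsTransport Φ t W) z ∧
      Φ.good.indicator (hsTransport Φ t W) z ≤ hsTransport Φ t W z := by
  by_cases hz : z ∈ Φ.good
  · rw [Set.indicator_of_mem hz]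
    exact ⟨hW0 _, le_rfl⟩
  · rw [Set.indicator_of_notMem hz]
    exact ⟨le_rfl, hW0 _⟩

/-- Integrals against the time-`t` law are integrals against the density
`1_{good} · W ∘ Φ_{-t}`. [folklore] -/
theorem integral_map_flow_particleLaw (Φ : HardSphereFlow G ε N) {W : Config N d X → ℝ}
    (hWm : Measurable W) (hW0 : 0 ≤ W) (t : ℝ) (g : Config N d X → ℝ) :
    ∫ w, g w ∂(particleLaw Φ W).map (Φ.flow t) =
      ∫ z, g z * Φ.good.indicator (hsTransport Φ t W) z := by
  have hm : Measurable fun z => ENNReal.ofReal (Φ.good.indicator (hsTransport Φ t W) z) :=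
    ENNReal.measurable_ofReal.comp
      ((hWm.comp (Φ.measurable_flow (-t))).indicator Φ.measurableSet_good)
  rw [map_flow_particleLaw Φ hWm t, integral_withDensity_eq_integral_toReal_smul hm
    (Eventually.of_forall fun _ => ENNReal.ofReal_lt_top)]
  refine integral_congr_ae (Eventually.of_forall fun z => ?_)
  simp only [smul_eq_mul, ENNReal.toReal_ofReal (indicator_hsTransport_le Φ hW0 t z).1, mul_comm]

end Laws

/-! ## Permutation symmetry of the time-`t` law -/

section Perm

/-- Relabelling of particles `z ↦ z ∘ σ` as a volume-preserving measurable equivalence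
(Mathlib's `piCongrLeft` along `σ⁻¹`). [folklore] -/
theorem exists_permEquiv (F : Type*) [MeasureSpace F] [SigmaFinite (volume : Measure F)] {N : ℕ}
    (σ : Equiv.Perm (Fin N)) :
    ∃ e : (Fin N → F) ≃ᵐ (Fin N → F), (∀ z, e z = z ∘ σ) ∧ MeasurePreserving e volume volume := by
  refine ⟨MeasurableEquiv.piCongrLeft (fun _ : Fin N => F) σ.symm, fun z => ?_,
    volume_measurePreserving_piCongrLeft (fun _ : Fin N => F) σ.symm⟩
  funext i
  simp [MeasurableEquiv.coe_piCongrLeft, Equiv.piCongrLeft_apply_eq_cast]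

/-- For `i ≠ j` in `Fin N` there is a permutation sending `0 ↦ i`, `1 ↦ j`. [folklore] -/
theorem exists_perm_apply_zero_one {N : ℕ} {i j : Fin N} (hij : i ≠ j) (h1 : 1 < N) :
    ∃ σ : Equiv.Perm (Fin N), σ ⟨0, by omega⟩ = i ∧ σ ⟨1, h1⟩ = j := by
  classical
  set i0 : Fin N := ⟨0, by omega⟩
  set i1 : Fin N := ⟨1, h1⟩
  have h01 : i0 ≠ i1 := by simp [i0, i1, Fin.ext_iff]
  set τ₁ := Equiv.swap i0 i
  set m := τ₁ i1 with hm
  set τ₂ := Equiv.swap m j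
  refine ⟨τ₁.trans τ₂, ?_, ?_⟩
  · rw [Equiv.trans_apply, Equiv.swap_apply_left]
    refine Equiv.swap_apply_of_ne_of_ne (fun him => ?_) hij
    have : τ₁ i = τ₁ m := by rw [← him]
    rw [hm, Equiv.swap_apply_self, Equiv.swap_apply_right] at this
    exact h01 this
  · rw [Equiv.trans_apply, ← hm, Equiv.swap_apply_left]

variable [Fintype d] [MeasureSpace X] [TopologicalSpace X] [SigmaFinite (volume : Measure X)]
  {G : Geometry d X} {ε : ℝ} {N : ℕ}

/-- **Symmetry of the law at time `t`**: if the flow is Liouville-a.e. equivariant under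
the relabelling `σ` of the particles (`HardSphereFlow.flow_comp_perm_ae`, a consequence of the
uniqueness of hard-sphere trajectories) and the initial density `W` is symmetric, then the law at
time `t` is `σ`-invariant: `E[F(w ∘ σ)] = E[F(w)]` for measurable `F` (GST 2013 §1.1,
§4.2: the `N`-particle distribution stays symmetric). [folklore] -/
theorem integral_comp_perm_map_flow_particleLaw (Φ : HardSphereFlow G ε N)
    {W : Config N d X → ℝ} (hWs : IsSymmetricFn W) (hWm : Measurable W) (hW0 : 0 ≤ W)
    (hWD : ∀ z ∉ hardSphereDomain G N ε, W z = 0) {t : ℝ} {σ : Equiv.Perm (Fin N)}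
    (hσ : ∀ᵐ z ∂liouville G N ε, Φ.flow t (z ∘ σ) = Φ.flow t z ∘ σ)
    {F : Config N d X → ℝ} (hFm : Measurable F) :
    ∫ w, F (w ∘ σ) ∂(particleLaw Φ W).map (Φ.flow t) =
      ∫ w, F w ∂(particleLaw Φ W).map (Φ.flow t) := by
  have hpm : Measurable fun w : Config N d X => w ∘ σ :=
    measurable_pi_lambda _ fun i => measurable_pi_apply (σ i)
  have hFσ : Measurable fun w : Config N d X => F (w ∘ σ) := hFm.comp hpm
  rw [integral_map (Φ.measurable_flow t).aemeasurable hFσ.aestronglyMeasurable,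
    integral_map (Φ.measurable_flow t).aemeasurable hFm.aestronglyMeasurable]
  -- transport the a.e. equivariance from Liouville to the initial law
  have hac : particleLaw Φ W ≪ liouville G N ε := withDensity_absolutelyContinuous _ _
  have hae : (fun z => F (Φ.flow t z ∘ σ)) =ᵐ[particleLaw Φ W] fun z => F (Φ.flow t (z ∘ σ)) := by
    filter_upwards [hac.ae_le hσ] with z hz
    rw [hz]
  have hWm' : Measurable fun z => ENNReal.ofReal (W z) := ENNReal.measurable_ofReal.comp hWm
  rw [integral_congr_ae hae, particleLaw_eq_withDensity Φ hWD,
    integral_withDensity_eq_integral_toReal_smul hWm'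
      (Eventually.of_forall fun _ => ENNReal.ofReal_lt_top),
    integral_withDensity_eq_integral_toReal_smul hWm'
      (Eventually.of_forall fun _ => ENNReal.ofReal_lt_top)]
  simp only [ENNReal.toReal_ofReal (hW0 _), smul_eq_mul]
  -- change variables `z ↦ z ∘ σ` (volume preserving) and use the symmetry of `W`
  obtain ⟨e, he, hmp⟩ := exists_permEquiv (X × EuclideanSpace ℝ d) σ
  conv_rhs => rw [← hmp.integral_comp']
  refine integral_congr_ae (Eventually.of_forall fun z => ?_)
  simp only [he, hWs σ z]

end Perm

/-! ## Assembly: mode A ⇒ mode B -/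

section Assembly

variable [Fintype d] [MeasureSpace X] [TopologicalSpace X]

/-- **Mode A ⇒ mode B for hard spheres, given a.e. permutation equivariance of the flows**
(Sznitman 1991 Prop. 2.2 (i)⇒(ii), in the form of Chaintron–Diez 2022 Lemma 3.19). This is
`TendstoMarginals.tendstoEmpirical` with the symmetry of the time-`t` laws supplied through the
hypothesis `hΦσ` (Liouville-a.e. `Φ_t(z ∘ σ) = Φ_t(z) ∘ σ`), and without the (unused) local
compactness of `X`. Proof: the law of `Φ_t z` has density `1_{good} W ∘ Φ_{-t} ≤ W ∘ Φ_{-t}`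
whose deficit of mass tends to `0` by mode A at `s = 0`, so
`E[φ^{⊗s}(w_0, …, w_{s-1})] - ∫ φ^{⊗s} F_k^{(s)} → 0`; the latter tends to `(∫∫ φ f)^s` for
`s = 1, 2` (`TendstoMarginals.tendsto_integral_tensorPow_mul_nthMarginal`); symmetry reduces
all one/two-particle expectations to these; the Chebyshev computation of `KacChaos`
(`tendsto_measure_empiricalAverage_sub`) concludes. [cite: Sznitman1991, Prop. 2.2 (i)⇒(ii)] -/
theorem tendstoEmpirical_of_flow_comp_perm_ae [T2Space X] [SigmaCompactSpace X] [BorelSpace X]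
    [IsFiniteMeasureOnCompacts (volume : Measure X)] [NullSingletonClass (volume : Measure X)]
    {G : Geometry d X} {Nk : ℕ → ℕ} {εk : ℕ → ℝ}
    (hN : Tendsto Nk atTop atTop) (Φk : (k : ℕ) → HardSphereFlow G (εk k) (Nk k))
    (hΦσ : ∀ k (σ : Equiv.Perm (Fin (Nk k))) (t : ℝ),
      ∀ᵐ z ∂liouville G (Nk k) (εk k), (Φk k).flow t (z ∘ σ) = (Φk k).flow t z ∘ σ)
    {Wk : (k : ℕ) → Config (Nk k) d X → ℝ} (hWs : ∀ k, IsSymmetricFn (Wk k))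
    (hWm : ∀ k, Measurable (Wk k)) (hW0 : ∀ k, 0 ≤ Wk k)
    (hWD : ∀ k, ∀ z ∉ hardSphereDomain G (Nk k) (εk k), Wk k z = 0)
    (hW1 : ∀ k, ∫ z, Wk k z = 1) {f : ℝ → X × EuclideanSpace ℝ d → ℝ} {T : ℝ}
    (hf0 : ∀ t ∈ Icc 0 T, 0 ≤ f t)
    (hf1 : ∀ t ∈ Icc 0 T, ∫ x : X, ∫ v : EuclideanSpace ℝ d, f t (x, v) = 1)
    (h : TendstoMarginals (fun k s t => nthMarginal (Nk k) s (hsTransport (Φk k) t (Wk k)))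
      (fun s t => tensorPow s (f t)) T) :
    TendstoEmpirical Nk (fun k => particleLaw (Φk k) (Wk k)) (fun k => (Φk k).flow) f T := by
  classical
  intro t ht φ hφc hφs δ hδ
  -- notation: the laws at time `t`, the raw transported densities, the true densities
  set Q : (k : ℕ) → Measure (Config (Nk k) d X) :=
    fun k => (particleLaw (Φk k) (Wk k)).map ((Φk k).flow t) with hQdef
  haveI hQ : ∀ k, IsProbabilityMeasure (Q k) := fun k =>
    isProbabilityMeasure_map_flow_particleLaw (Φk k) (hW0 k) (hWD k) (hW1 k) t
  set ρt : (k : ℕ) → ℝ → Config (Nk k) d X → ℝ := fun k t' => hsTransport (Φk k) t' (Wk k)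
    with hρtdef
  set ρ : (k : ℕ) → Config (Nk k) d X → ℝ := fun k => (Φk k).good.indicator (ρt k t) with hρdef
  set c : ℝ := ∫ x : X, ∫ v : EuclideanSpace ℝ d, φ (x, v) * f t (x, v) with hc
  have hφm : Measurable φ := hφc.measurable
  obtain ⟨M, hM⟩ : ∃ M, ∀ e, |φ e| ≤ M := by
    obtain ⟨M, hM⟩ := hφs.exists_bound_of_continuous hφc
    exact ⟨M, fun e => by simpa using hM e⟩
  have hρtm : ∀ k t', Measurable (ρt k t') := fun k t' =>
    (hWm k).comp ((Φk k).measurable_flow (-t'))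
  have hρt0 : ∀ k t', 0 ≤ ρt k t' := fun k t' z => hW0 k ((Φk k).flow (-t') z)
  -- Step 1: the total mass of the raw transported density tends to `1`
  set m : ℕ → ℝ := fun k => ∫ z, ρt k t z with hmdef
  have hm : Tendsto m atTop (𝓝 1) := by
    have := h.tendsto_apply_zero ht (fun i => i.elim0)
    simp only [nthMarginal_zero_apply, tensorPow_zero] at this
    exact this
  have hint : ∀ᶠ k in atTop, Integrable (ρt k t) := by
    filter_upwards [(tendsto_order.1 hm).1 (1 / 2) (by norm_num)] with k hk
    by_contra hnot
    have : m k = 0 := integral_undef hnot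
    rw [this] at hk
    norm_num at hk
  -- Step 2: the density of `Q k` and its mass deficit
  have hρint : ∀ k (g : Config (Nk k) d X → ℝ), ∫ w, g w ∂Q k = ∫ z, g z * ρ k z := fun k g =>
    integral_map_flow_particleLaw (Φk k) (hWm k) (hW0 k) t g
  have hρle : ∀ k z, 0 ≤ ρ k z ∧ ρ k z ≤ ρt k t z := fun k z =>
    indicator_hsTransport_le (Φk k) (hW0 k) t z
  have hρ1 : ∀ k, ∫ z, ρ k z = 1 := fun k => by
    have := hρint k fun _ => 1
    simp only [one_mul, integral_const, probReal_univ, smul_eq_mul, mul_one] at this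
    exact this.symm
  have hρi : ∀ k, Integrable (ρ k) := fun k => by
    by_contra hnot
    have := hρ1 k
    rw [integral_undef hnot] at this
    exact zero_ne_one this
  -- Step 3: `∫ φ^{⊗s}(z_0, …, z_{s-1}) ρ_k(z) dz → c ^ s` whenever the core theorem applies
  have hcore : ∀ s : ℕ, (∀ P : (Fin s → X) → Prop, MeasurableSet {xs | P xs} →
      (∀ xs ∈ offDiag (X := X) s, P xs) → ∀ᵐ xs : Fin s → X, P xs) →
      Tendsto (fun k => if hs : s ≤ Nk k then
        ∫ z, tensorPow s φ (fun i => z (Fin.castLE hs i)) * ρ k z else c ^ s) atTop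
        (𝓝 (c ^ s)) := by
    intro s hnull
    have hB := h.tendsto_integral_tensorPow_mul_nthMarginal hN (ρ := ρt) hρtm hρt0 hf0 hf1 ht
      hφc hφs s hnull
    have hGm : Measurable (tensorPow s φ : Config s d X → ℝ) := measurable_tensorPow hφm s
    have hGb : ∀ zs : Config s d X, |tensorPow s φ zs| ≤ M ^ s := abs_tensorPow_le hM s
    have hproj : ∀ k (hs : s ≤ Nk k), Measurable fun (z : Config (Nk k) d X) (i : Fin s) =>
        z (Fin.castLE hs i) := fun k hs => measurable_pi_lambda _ fun i => measurable_pi_apply _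
    -- the difference to the integral against the raw density tends to `0`
    have hdiff : Tendsto (fun k => (if hs : s ≤ Nk k then
        ∫ z, tensorPow s φ (fun i => z (Fin.castLE hs i)) * ρ k z else c ^ s) -
        ∫ zs, tensorPow s φ zs * nthMarginal (Nk k) s (ρt k t) zs) atTop (𝓝 0) := by
      have h0 : Tendsto (fun k => M ^ s * (m k - 1)) atTop (𝓝 0) := by
        have := (hm.sub_const 1).const_mul (M ^ s)
        simpa using this
      refine squeeze_zero_norm' ?_ h0
      filter_upwards [hN.eventually_ge_atTop s, hint] with k hs hk
      rw [Real.norm_eq_abs, dif_pos hs, ← integral_mul_nthMarginal hs hk hGm hGb, abs_sub_comm]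
      have key := abs_integral_mul_sub_le (μ := volume) (hρi k) hk (hρle k)
        ((hGm.comp (hproj k hs)).aestronglyMeasurable) (fun z => hGb _)
      rwa [hρ1 k] at key
    have := hB.add hdiff
    simp only [add_zero] at this
    exact this.congr' (Eventually.of_forall fun k => by ring)
  -- Step 4: one- and two-particle expectations via symmetry
  set a : ℕ → ℝ := fun k => if hn : 0 < Nk k then ∫ w, φ (w ⟨0, hn⟩) ∂Q k else 0 with hadef
  set b : ℕ → ℝ := fun k => if hn : 1 < Nk k then
    ∫ w, φ (w ⟨0, by omega⟩) * φ (w ⟨1, hn⟩) ∂Q k else 0 with hbdef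
  have hsymm : ∀ k (σ : Equiv.Perm (Fin (Nk k))) (F : Config (Nk k) d X → ℝ), Measurable F →
      ∫ w, F (w ∘ σ) ∂Q k = ∫ w, F w ∂Q k := fun k σ F hF =>
    integral_comp_perm_map_flow_particleLaw (Φk k) (hWs k) (hWm k) (hW0 k) (hWD k) (hΦσ k σ t) hF
  have ha : ∀ k (i : Fin (Nk k)), ∫ w, φ (w i) ∂Q k = a k := by
    intro k i
    simp only [hadef, i.pos, dif_pos]
    have := hsymm k (Equiv.swap ⟨0, i.pos⟩ i) (fun w => φ (w ⟨0, i.pos⟩))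
      (hφm.comp (measurable_pi_apply _))
    simpa [Function.comp, Equiv.swap_apply_left] using this
  have hb : ∀ k (i j : Fin (Nk k)), i ≠ j → ∫ w, φ (w i) * φ (w j) ∂Q k = b k := by
    intro k i j hij
    have h1 : 1 < Nk k := by
      have : Nontrivial (Fin (Nk k)) := ⟨⟨i, j, hij⟩⟩
      exact Fin.nontrivial_iff_two_le.1 this
    simp only [hbdef, h1, dif_pos]
    obtain ⟨σ, hσ0, hσ1⟩ := exists_perm_apply_zero_one hij h1
    have := hsymm k σ (fun w => φ (w ⟨0, by omega⟩) * φ (w ⟨1, h1⟩))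
      ((hφm.comp (measurable_pi_apply _)).mul (hφm.comp (measurable_pi_apply _)))
    simpa [Function.comp, hσ0, hσ1] using this
  -- Step 5: their limits
  have ha' : Tendsto a atTop (𝓝 c) := by
    have h1 := hcore 1 (fun P _ hP => Eventually.of_forall fun xs =>
      hP xs fun i j hij => absurd (Subsingleton.elim i j) hij)
    rw [pow_one] at h1
    refine h1.congr' ?_
    filter_upwards [hN.eventually_ge_atTop 1] with k hk
    have hn : 0 < Nk k := hk
    rw [dif_pos hk]
    simp only [hadef, dif_pos hn]
    rw [hρint k]
    refine integral_congr_ae (Eventually.of_forall fun z => ?_)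
    have hidx : Fin.castLE hk 0 = ⟨0, hn⟩ := Fin.ext (by simp)
    simp only [tensorPow, Fin.prod_univ_one, hidx]
  have hb' : Tendsto b atTop (𝓝 (c ^ 2)) := by
    have h2 := hcore 2 (fun P hP hall => ae_of_forall_offDiag_two hP hall)
    refine h2.congr' ?_
    filter_upwards [hN.eventually_ge_atTop 2] with k hk
    have hn : 1 < Nk k := hk
    rw [dif_pos hk]
    simp only [hbdef, dif_pos hn]
    rw [hρint k]
    refine integral_congr_ae (Eventually.of_forall fun z => ?_)
    have hidx0 : Fin.castLE hk 0 = ⟨0, by omega⟩ := Fin.ext (by simp)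
    have hidx1 : Fin.castLE hk 1 = ⟨1, hn⟩ := Fin.ext (by simp)
    simp only [tensorPow, Fin.prod_univ_two, hidx0, hidx1]
  -- Step 6: Chebyshev (`KacChaos`) and the identification of the events
  have hK := tendsto_measure_empiricalAverage_sub hN Q hφm hM ha hb ha' hb' hδ
  refine hK.congr' (Eventually.of_forall fun k => ?_)
  have hSm : MeasurableSet {w : Config (Nk k) d X | δ < |empiricalAverage φ w - c|} :=
    measurableSet_lt measurable_const
      ((measurable_empiricalAverage hφm).sub measurable_const).abs
  have hset : (Φk k).flow t ⁻¹' {w : Config (Nk k) d X | δ < |empiricalAverage φ w - c|} =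
      {z | δ < |∫ y, φ y ∂empiricalMeasure ((Φk k).flow t z) - c|} := by
    ext z
    simp only [Set.mem_preimage, Set.mem_setOf_eq, integral_empiricalMeasure, empiricalAverage]
  simp only [hQdef]
  rw [Measure.map_apply ((Φk k).measurable_flow t) hSm, hset]

/-- **Mode A implies mode B** (Sznitman 1991 Prop. 2.2 (i)⇒(ii); Chaintron–Diez 2022
Lemma 3.19): discharge of the named fact `TendstoMarginals.tendstoEmpirical`, exactly as
stated in `Literature.Analysis.FluidPDE.BoltzmannGradLimit`. The symmetry of the time-`t` laws
comes from `HardSphereFlow.flow_comp_perm_ae` (uniqueness of hard-sphere trajectories over a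
Hausdorff position space); everything else is `tendstoEmpirical_of_flow_comp_perm_ae`. [cite: Sznitman1991, Prop. 2.2 (i)⇒(ii)] -/
theorem TendstoMarginals.tendstoEmpirical_holds :
    TendstoMarginals.tendstoEmpirical (d := d) (X := X) := by
  intro _ _ _ _ _ _ G Nk εk hN Φk Wk hWs hWm hW0 hWD hW1 f T hf0 hf1 h
  exact tendstoEmpirical_of_flow_comp_perm_ae hN Φk (fun k σ t => (Φk k).flow_comp_perm_ae σ t)
    hWs hWm hW0 hWD hW1 hf0 hf1 h

end Assembly

end Kinetic

end

end Literature.Analysis.FluidPDE
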